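import Mathlib
import Literature.Analysis.FluidPDE.GalerkinFlow
import HarnessLib

/-!
# Piece P2 `UniformTailEstimates` of the tail-lift split of crux stmt-AnomalousDissipation-10352
# (`WazewskiBlock.UniformGalerkinTrap`) — PROVED (crux-strategist r1, 2026-08-17)

Sorry-free; axioms `propext`, `Classical.choice`, `Quot.sound`.  The final theorem `stub_uniformTailEstimates` has VERBATIM
the signature of the registered stub of line `TailLift` (= the second hypothesis of
`TailLiftSplit.uniformGalerkinTrap_of_tailLift`, = the route leaf-to-be `UniformTailEstimates`); a prover lands this file
under `Theorems/` with `--supports stmt-AnomalousDissipation-10352` (planners cannot write `Theorems/`).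

## Statement (the `N`-uniform Zgliczyński–Mischaikow tail inequalities of the profile `â_k = A θ^{|k|₁}(1+|k|₁)^{-6}`)

∀ `ν A θ δ > 0`, `θ < 1`, ∃ `M` ∀ `M ≤ m ≤ N` ∀ `x : ↥(freqBall N) → ℂ³` with `‖x k‖ ≤ â_k`:
(i) per-mode tail ENTRANCE — `m² < |k|²`, `g k = 0`, `‖x k‖ = â_k` ⟹ `Re⟪x k, (galerkinRHS ν g x) k⟫ < 0`;
(ii) modewise low/tail COUPLING — ∀ `f`, ∀ `k` of order `m`:
`‖(F_N x)_k − (F_m (x|_{≤m}))_k‖ ≤ ν A θ^{max(|k|₁,m)} (1+max(|k|₁,m))^{-4}`;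
(iii)/(iv) tail energy/enstrophy — `½∑_{≤N}‖x k‖² ≤ ½∑_{≤m}‖x k‖² + δ`, `4π²∑_{≤N}|k|²‖x k‖² ≤ 4π²∑_{≤m}|k|²‖x k‖² + δ`.

## Proof

* §1 `|k|₁ = ∑|kᵢ|` (`l1`): `|k|₂² ≤ |k|₁² ≤ 3|k|₂²`, subadditivity, `m² < |k|₂² ⇒ m+1 ≤ |k|₁`, `|k|₂² ≤ m² ⇒ |k|₁ ≤ 2m`,
  `|∑ cⱼ mⱼ| ≤ ‖c‖ |m|₁`.
* §2 THE LATTICE CONSTANT `C = latC = (∑_{n∈ℤ}(1+|n|)^{-2})³` (summable by comparison with `1/n²`): for EVERY finite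
  `T ⊂ ℤ³`, `∑_{j∈T}(1+|j|₁)^{-6} ≤ C` (`latticeSum_le`) — via `(1+|j|₁)³ ≥ ∏ᵢ(1+|jᵢ|)` (expand the cube), a box
  `T ⊆ [-R,R]³`, `Finset.prod_univ_sum` and `∑_{finite} ≤ ∑'`.  No shell counting, no fractional powers.
* §3 profile algebra (`prof(k−l')·|l'|₁·prof(l') ≤ A²θ^{|k|₁}(1+|k−l'|₁)^{-6}(1+|l'|₁)^{-5}`) and THE KEY WEIGHTED SUM
  `keySum_le`: `∑_{l'∈T, m ≤ |l'|₁}(1+|k−l'|₁)^{-6}(1+|l'|₁)^{-5} ≤ 96 C (1+max(|k|₁,m))^{-5}` (regions `2|l'|₁ ≥ |k|₁` /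
  `<`; in the second `|k−l'|₁ > |k|₁/2` and one power of `(1+|l'|₁)` is spent against `(1+|k|₁)`).
* §4 `‖B(c,c')_k‖ ≤ 2π∑_{l'}‖c(k−l')‖ |l'|₁ ‖c' l'‖` (the `l`-sum collapses on `l = k − l'`), hence inside the box
  `‖B(x,x)_k‖ ≤ 192 π C A (1+|k|₁) prof(k)`.
* §5 clause (i): `Re⟪x_k,(F x)_k⟫ = −4π²ν|k|₂²‖x_k‖² + Re⟪x_k, L_k(−B_k)⟫ ≤ prof²(192πCA(1+|k|₁) − 4π²ν|k|₂²) < 0` once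
  `288 C A < π ν (m+1)` (`|k|₁ ≥ m+1`, `|k|₁² ≤ 3|k|₂²`).
* §6 clauses (iii)/(iv): split the sums at `|k| = m`; in the tail `prof(k)² ≤ A²θ^{2m}(1+|k|₁)^{-6}`,
  `|k|₂² prof(k)² ≤ A²θ^{2m}(1+|k|₁)^{-6}`, so both tails are `≤ (·) A²θ^{2m} C`.
* §7 clause (ii): at `k` of order `m` the linear and force terms cancel, the difference is
  `L_k(B^m_k − B^N_k)`; `B^m = B_{freqBall N}(x𝟙_{≤m}, x𝟙_{≤m})`; bilinearity splits `B^N − B^m = B(z, x) + B(x𝟙_{≤m}, z)`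
  with `z = x𝟙_{>m}`; each pair has its OUTSIDE member beyond `m` (`θ`-exponent `≥ max(|k|₁, m)`), the `|l'|₁` weight is
  paid by the outside member (`|l'|₁ ≤ 3(1+|k−l'|₁)` when `|k|₁ ≤ 2m`), and `keySum_le` (once reindexed by
  `l' ↦ k − l'`) gives `‖·‖ ≤ 768 π C A² θ^ρ (1+ρ)^{-5} ≤ ν A θ^ρ (1+ρ)^{-4}` once `768 π C A ≤ ν (m+1)`.
* §8 `M = max M₀ (max M₁ M₂)` by Archimedes and `exists_pow_lt_of_lt_one`.

References: Zgliczyński–Mischaikow, FoCM 1 (2001) §3 (self-consistent a-priori bounds); Foias–Temam, JFA 87 (1989);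
Robinson–Rodrigo–Sadowski 2016 Thm 4.4 (4.5); tree: `convectionCoeff_def`, `galerkinField_def`, `norm_leraySym_le`.
-/

noncomputable section

set_option linter.dupNamespace false

namespace Summit.AnomalousDissipation.AnomalousDissipation.Cruxes.UniformGalerkinTrap.TailEstimates

open scoped InnerProductSpace ENNReal NNReal
open MeasureTheory Set Filter Topology
open Literature.Analysis.FunctionSpaces Literature.Analysis.FunctionSpaces.Torus
open Literature.Analysis.FluidPDE Literature.Analysis.FluidPDE.Torus

/-! ## §1 The ℓ¹ size of a frequency and elementary inequalities -/

/-- `|k|₁ = ∑ᵢ |kᵢ|` as a natural number. -/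
def l1 (k : Fin 3 → ℤ) : ℕ := ∑ i, (k i).natAbs

theorem l1_nonneg_real (k : Fin 3 → ℤ) : (0 : ℝ) ≤ l1 k := Nat.cast_nonneg _

theorem cast_l1 (k : Fin 3 → ℤ) : ((l1 k : ℕ) : ℝ) = ∑ i, |((k i : ℤ) : ℝ)| := by
  unfold l1
  push_cast
  refine Finset.sum_congr rfl fun i _ => ?_
  rw [Nat.cast_natAbs, Int.cast_abs]

theorem l1_neg (k : Fin 3 → ℤ) : l1 (-k) = l1 k := by
  unfold l1; simp

theorem l1_add_le (k l : Fin 3 → ℤ) : l1 (k + l) ≤ l1 k + l1 l := by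
  unfold l1
  rw [← Finset.sum_add_distrib]
  exact Finset.sum_le_sum fun i _ => Int.natAbs_add_le _ _

theorem l1_sub_le (k l : Fin 3 → ℤ) : l1 (k - l) ≤ l1 k + l1 l := by
  have := l1_add_le k (-l)
  rwa [l1_neg, ← sub_eq_add_neg] at this

theorem l1_le_l1_sub_add (k l : Fin 3 → ℤ) : l1 k ≤ l1 (k - l) + l1 l := by
  have := l1_add_le (k - l) l
  rwa [sub_add_cancel] at this

/-- `|k|₂² ≤ |k|₁²`. -/
theorem freqNormSq_le_l1_sq (k : Fin 3 → ℤ) : freqNormSq k ≤ ((l1 k : ℕ) : ℝ) ^ 2 := by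
  rw [cast_l1, freqNormSq]
  have h : ∀ i, ((k i : ℤ) : ℝ) ^ 2 = |((k i : ℤ) : ℝ)| ^ 2 := fun i => (sq_abs _).symm
  simp_rw [h]
  exact Finset.sum_sq_le_sq_sum_of_nonneg fun i _ => abs_nonneg _

/-- `|k|₁² ≤ 3 |k|₂²` (Cauchy–Schwarz on three coordinates). -/
theorem l1_sq_le_three_mul_freqNormSq (k : Fin 3 → ℤ) : ((l1 k : ℕ) : ℝ) ^ 2 ≤ 3 * freqNormSq k := by
  rw [cast_l1, freqNormSq, Fin.sum_univ_three, Fin.sum_univ_three]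
  have h0 := sq_abs ((k 0 : ℤ) : ℝ); have h1 := sq_abs ((k 1 : ℤ) : ℝ); have h2 := sq_abs ((k 2 : ℤ) : ℝ)
  nlinarith [sq_nonneg (|((k 0 : ℤ) : ℝ)| - |((k 1 : ℤ) : ℝ)|), sq_nonneg (|((k 1 : ℤ) : ℝ)| - |((k 2 : ℤ) : ℝ)|),
    sq_nonneg (|((k 0 : ℤ) : ℝ)| - |((k 2 : ℤ) : ℝ)|)]

/-- A frequency with `m² < |k|₂²` has `m + 1 ≤ |k|₁`. -/
theorem succ_le_l1_of_sq_lt {m : ℕ} {k : Fin 3 → ℤ} (h : ((m : ℕ) : ℝ) ^ 2 < freqNormSq k) : m + 1 ≤ l1 k := by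
  have h2 : ((m : ℕ) : ℝ) ^ 2 < ((l1 k : ℕ) : ℝ) ^ 2 := h.trans_le (freqNormSq_le_l1_sq k)
  have h3 : (m : ℝ) < (l1 k : ℕ) := by
    exact lt_of_pow_lt_pow_left₀ 2 (Nat.cast_nonneg _) h2
  exact_mod_cast h3

/-- A frequency in the ball `|k|₂² ≤ m²` has `|k|₁ ≤ 2 m` (indeed `≤ √3 m`). -/
theorem l1_le_two_mul_of_sq_le {m : ℕ} {k : Fin 3 → ℤ} (h : freqNormSq k ≤ ((m : ℕ) : ℝ) ^ 2) : l1 k ≤ 2 * m := by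
  have h2 : ((l1 k : ℕ) : ℝ) ^ 2 ≤ 3 * ((m : ℕ) : ℝ) ^ 2 := (l1_sq_le_three_mul_freqNormSq k).trans (by linarith)
  have h3 : ((l1 k : ℕ) : ℝ) ^ 2 < ((2 * m + 1 : ℕ) : ℝ) ^ 2 := by
    push_cast; nlinarith [Nat.cast_nonneg (α := ℝ) m]
  have h4 : ((l1 k : ℕ) : ℝ) < ((2 * m + 1 : ℕ) : ℝ) := lt_of_pow_lt_pow_left₀ 2 (Nat.cast_nonneg _) h3
  have h5 : l1 k < 2 * m + 1 := by exact_mod_cast h4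
  omega

/-- Scalar part of the convection symbol: `|∑ⱼ cⱼ mⱼ| ≤ ‖c‖ |m|₁`. -/
theorem norm_sum_mul_le (c : EuclideanSpace ℂ (Fin 3)) (m : Fin 3 → ℤ) :
    ‖∑ j, c j * ((m j : ℤ) : ℂ)‖ ≤ ‖c‖ * ((l1 m : ℕ) : ℝ) := by
  rw [cast_l1, Finset.mul_sum]
  refine (norm_sum_le _ _).trans (Finset.sum_le_sum fun j _ => ?_)
  rw [norm_mul, Complex.norm_intCast]
  exact mul_le_mul_of_nonneg_right (PiLp.norm_apply_le c j) (abs_nonneg _)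

/-! ## §2 The lattice sum `∑ (1+|j|₁)^{-6}` is bounded uniformly over finite sets -/

/-- The one-dimensional majorant `(1+|n|)^{-2}` on `ℤ`. -/
def w1 (n : ℤ) : ℝ := ((1 + |(n : ℝ)|) ^ 2)⁻¹

theorem w1_nonneg (n : ℤ) : 0 ≤ w1 n := by unfold w1; positivity

theorem summable_w1 : Summable w1 := by
  have h1 : Summable fun n : ℤ => 1 / (n : ℝ) ^ 2 := Real.summable_one_div_int_pow.2 one_lt_two
  have h2 : Summable fun n : ℤ => if n = 0 then (1 : ℝ) else 0 :=
    summable_of_ne_finset_zero (s := {0}) (by intro b hb; simp [Finset.mem_singleton] at hb; simp [hb])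
  refine (h1.add h2).of_nonneg_of_le w1_nonneg fun n => ?_
  unfold w1
  by_cases hn : n = 0
  · subst hn; simp
  · simp only [hn, if_false, add_zero, one_div]
    have h0 : (0 : ℝ) < |(n : ℝ)| := by
      rw [abs_pos]; exact_mod_cast hn
    rw [← sq_abs (n : ℝ)]
    exact inv_anti₀ (by positivity) (by nlinarith)

/-- The lattice constant `C = (∑_{n∈ℤ} (1+|n|)^{-2})³`. -/
def latC : ℝ := (∑' n : ℤ, w1 n) ^ 3

theorem latC_nonneg : 0 ≤ latC := pow_nonneg (tsum_nonneg w1_nonneg) 3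

theorem sum_w1_le (s : Finset ℤ) : ∑ n ∈ s, w1 n ≤ ∑' n : ℤ, w1 n :=
  summable_w1.sum_le_tsum s fun n _ => w1_nonneg n

/-- `(1+|j|₁)³ ≥ ∏ᵢ (1+|jᵢ|)` (expand the cube). -/
theorem prod_le_cube (j : Fin 3 → ℤ) : ∏ i, (1 + |((j i : ℤ) : ℝ)|) ≤ (1 + ((l1 j : ℕ) : ℝ)) ^ 3 := by
  rw [cast_l1, Fin.prod_univ_three, Fin.sum_univ_three]
  set a := |((j 0 : ℤ) : ℝ)|; set b := |((j 1 : ℤ) : ℝ)|; set c := |((j 2 : ℤ) : ℝ)|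
  have ha : 0 ≤ a := abs_nonneg _; have hb : 0 ≤ b := abs_nonneg _; have hc : 0 ≤ c := abs_nonneg _
  nlinarith [mul_nonneg ha hb, mul_nonneg hb hc, mul_nonneg ha hc, mul_nonneg (mul_nonneg ha hb) hc,
    mul_nonneg (mul_nonneg ha ha) ha, mul_nonneg (mul_nonneg hb hb) hb, mul_nonneg (mul_nonneg hc hc) hc,
    mul_nonneg (mul_nonneg ha ha) hb, mul_nonneg (mul_nonneg ha ha) hc, mul_nonneg (mul_nonneg hb hb) ha,
    mul_nonneg (mul_nonneg hb hb) hc, mul_nonneg (mul_nonneg hc hc) ha, mul_nonneg (mul_nonneg hc hc) hb]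

/-- Pointwise: `(1+|j|₁)^{-6} ≤ ∏ᵢ (1+|jᵢ|)^{-2}`. -/
theorem inv_pow_six_le_prod (j : Fin 3 → ℤ) :
    ((1 + ((l1 j : ℕ) : ℝ)) ^ 6)⁻¹ ≤ ∏ i, w1 (j i) := by
  have hp : ∏ i, w1 (j i) = ((∏ i, (1 + |((j i : ℤ) : ℝ)|)) ^ 2)⁻¹ := by
    unfold w1
    rw [Finset.prod_inv_distrib, ← Finset.prod_pow]
  rw [hp]
  have h0 : 0 < ∏ i, (1 + |((j i : ℤ) : ℝ)|) := Finset.prod_pos fun i _ => by positivity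
  refine inv_anti₀ (by positivity) ?_
  calc (∏ i, (1 + |((j i : ℤ) : ℝ)|)) ^ 2 ≤ ((1 + ((l1 j : ℕ) : ℝ)) ^ 3) ^ 2 :=
        pow_le_pow_left₀ h0.le (prod_le_cube j) 2
    _ = (1 + ((l1 j : ℕ) : ℝ)) ^ 6 := by ring

/-- **Uniform bound of the lattice sum**: for every finite `T ⊂ ℤ³`, `∑_{j∈T} (1+|j|₁)^{-6} ≤ C`. -/
theorem latticeSum_le (T : Finset (Fin 3 → ℤ)) :
    ∑ j ∈ T, ((1 + ((l1 j : ℕ) : ℝ)) ^ 6)⁻¹ ≤ latC := by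
  classical
  -- a box containing T
  obtain ⟨R, hR⟩ : ∃ R : ℤ, ∀ j ∈ T, ∀ i, |j i| ≤ R := by
    refine ⟨∑ j ∈ T, ∑ i, |j i|, fun j hj i => ?_⟩
    exact (Finset.single_le_sum (f := fun i => |j i|) (fun _ _ => abs_nonneg _) (Finset.mem_univ i)).trans
      (Finset.single_le_sum (f := fun j => ∑ i, |j i|) (fun _ _ => Finset.sum_nonneg fun _ _ => abs_nonneg _) hj)
  set box : Finset (Fin 3 → ℤ) := Fintype.piFinset fun _ : Fin 3 => Finset.Icc (-R) R with hbox
  have hT : T ⊆ box := by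
    intro j hj
    rw [hbox, Fintype.mem_piFinset]
    intro i
    rw [Finset.mem_Icc]
    exact abs_le.1 (hR j hj i)
  calc ∑ j ∈ T, ((1 + ((l1 j : ℕ) : ℝ)) ^ 6)⁻¹
      ≤ ∑ j ∈ T, ∏ i, w1 (j i) := Finset.sum_le_sum fun j _ => inv_pow_six_le_prod j
    _ ≤ ∑ j ∈ box, ∏ i, w1 (j i) :=
        Finset.sum_le_sum_of_subset_of_nonneg hT fun j _ _ => Finset.prod_nonneg fun i _ => w1_nonneg _
    _ = ∏ _i : Fin 3, ∑ n ∈ Finset.Icc (-R) R, w1 n := by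
        rw [hbox, Finset.prod_univ_sum]
    _ ≤ ∏ _i : Fin 3, ∑' n : ℤ, w1 n := by
        refine Finset.prod_le_prod (fun i _ => Finset.sum_nonneg fun n _ => w1_nonneg n) fun i _ => sum_w1_le _
    _ = latC := by rw [Finset.prod_const, Finset.card_univ, Fintype.card_fin]; rfl

/-- Shifted version: `∑_{j∈T} (1+|c - j|₁)^{-6} ≤ C`. -/
theorem latticeSum_shift_le (T : Finset (Fin 3 → ℤ)) (c : Fin 3 → ℤ) :
    ∑ j ∈ T, ((1 + ((l1 (c - j) : ℕ) : ℝ)) ^ 6)⁻¹ ≤ latC := by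
  classical
  have hinj : Set.InjOn (fun j => c - j) T := fun a _ b _ h => by simpa using h
  rw [← Finset.sum_image (g := fun j => c - j) (f := fun i => ((1 + ((l1 i : ℕ) : ℝ)) ^ 6)⁻¹) hinj]
  exact latticeSum_le _

/-! ## §3 The profile, the coupling majorant, and the key weighted lattice sum -/

/-- The Gevrey-type profile `A θ^{|k|₁} (1+|k|₁)^{-6}` (verbatim as in the pieces). -/
def prof (A θ : ℝ) (k : Fin 3 → ℤ) : ℝ :=
  A * θ ^ (∑ i, (k i).natAbs) / (1 + ∑ i, ((k i).natAbs : ℝ)) ^ 6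

/-- The modewise coupling majorant `ν A θ^{max(|k|₁,m)} (1+max(|k|₁,m))^{-4}` (verbatim as in the pieces). -/
def cpl (ν A θ : ℝ) (m : ℕ) (k : Fin 3 → ℤ) : ℝ :=
  ν * A * θ ^ (max (∑ i, (k i).natAbs) m) / (1 + ((max (∑ i, (k i).natAbs) m : ℕ) : ℝ)) ^ 4

theorem prof_eq (A θ : ℝ) (k : Fin 3 → ℤ) : prof A θ k = A * θ ^ (l1 k) / (1 + ((l1 k : ℕ) : ℝ)) ^ 6 := by
  unfold prof l1; push_cast; rfl

theorem cpl_eq (ν A θ : ℝ) (m : ℕ) (k : Fin 3 → ℤ) :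
    cpl ν A θ m k = ν * A * θ ^ (max (l1 k) m) / (1 + ((max (l1 k) m : ℕ) : ℝ)) ^ 4 := rfl

theorem prof_pos {A θ : ℝ} (hA : 0 < A) (hθ : 0 < θ) (k : Fin 3 → ℤ) : 0 < prof A θ k := by
  rw [prof_eq]; positivity

theorem prof_nonneg {A θ : ℝ} (hA : 0 ≤ A) (hθ : 0 ≤ θ) (k : Fin 3 → ℤ) : 0 ≤ prof A θ k := by
  rw [prof_eq]; positivity

/-- abbreviation: `q n = (1 + n)` as a real, the polynomial weight base. -/
theorem one_add_pos (n : ℕ) : (0 : ℝ) < 1 + (n : ℝ) := by positivity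

/-- **Product of two profile values against the `|l'|₁` weight** (`θ ≤ 1`):
`prof(k - l') · |l'|₁ · prof(l') ≤ A² θ^{|k|₁} (1+|k-l'|₁)^{-6} (1+|l'|₁)^{-5}`. -/
theorem prof_mul_l1_mul_prof_le {A θ : ℝ} (_hA : 0 ≤ A) (hθ : 0 ≤ θ) (hθ1 : θ ≤ 1) (k l' : Fin 3 → ℤ) :
    prof A θ (k - l') * ((l1 l' : ℕ) : ℝ) * prof A θ l' ≤
      A ^ 2 * θ ^ (l1 k) * (((1 + ((l1 (k - l') : ℕ) : ℝ)) ^ 6)⁻¹ * ((1 + ((l1 l' : ℕ) : ℝ)) ^ 5)⁻¹) := by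
  rw [prof_eq, prof_eq]
  have hpow : θ ^ (l1 (k - l')) * θ ^ (l1 l') ≤ θ ^ (l1 k) := by
    rw [← pow_add]
    exact pow_le_pow_of_le_one hθ hθ1 (l1_le_l1_sub_add k l')
  set a : ℝ := 1 + ((l1 (k - l') : ℕ) : ℝ) with ha
  set b : ℝ := 1 + ((l1 l' : ℕ) : ℝ) with hb
  have ha0 : 0 < a := by rw [ha]; positivity
  have hb0 : 0 < b := by rw [hb]; positivity
  have hlb : ((l1 l' : ℕ) : ℝ) ≤ b := by rw [hb]; linarith
  have hθk : 0 ≤ θ ^ (l1 k) := pow_nonneg hθ _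
  -- rewrite both sides as products and compare factor by factor
  have lhs_eq : A * θ ^ l1 (k - l') / a ^ 6 * ((l1 l' : ℕ) : ℝ) * (A * θ ^ l1 l' / b ^ 6) =
      A ^ 2 * (θ ^ l1 (k - l') * θ ^ l1 l') * ((a ^ 6)⁻¹ * (((l1 l' : ℕ) : ℝ) * (b ^ 6)⁻¹)) := by
    field_simp
  rw [lhs_eq]
  have h5 : ((l1 l' : ℕ) : ℝ) * (b ^ 6)⁻¹ ≤ (b ^ 5)⁻¹ := by
    rw [← div_eq_mul_inv, div_le_iff₀ (by positivity)]
    calc ((l1 l' : ℕ) : ℝ) ≤ b := hlb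
      _ = (b ^ 5)⁻¹ * b ^ 6 := by field_simp
  gcongr

/-- **The key weighted lattice sum.** For every finite `T`, centre `k` and floor `m`:
`∑_{l'∈T, m ≤ |l'|₁} (1+|k-l'|₁)^{-6} (1+|l'|₁)^{-5} ≤ 96 C (1+max(|k|₁,m))^{-5}`
(regions `2|l'|₁ ≥ |k|₁` — use the `(1+|l'|₁)^{-5}` factor — and `2|l'|₁ < |k|₁` — there `|k-l'|₁ > |k|₁/2` and one
power of `(1+|l'|₁)` is spent against `(1+|k|₁)`). -/
theorem keySum_le (T : Finset (Fin 3 → ℤ)) (k : Fin 3 → ℤ) (m : ℕ) :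
    ∑ l' ∈ T.filter (fun l' => m ≤ l1 l'),
        ((1 + ((l1 (k - l') : ℕ) : ℝ)) ^ 6)⁻¹ * ((1 + ((l1 l' : ℕ) : ℝ)) ^ 5)⁻¹ ≤
      96 * latC * ((1 + ((max (l1 k) m : ℕ) : ℝ)) ^ 5)⁻¹ := by
  classical
  set F := T.filter (fun l' => m ≤ l1 l') with hF
  set P : ℝ := 1 + ((max (l1 k) m : ℕ) : ℝ) with hP
  have hP0 : 0 < P := by rw [hP]; positivity
  rw [← Finset.sum_filter_add_sum_filter_not F (fun l' => l1 k ≤ 2 * l1 l')]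
  -- region 1
  have h1 : ∑ l' ∈ F.filter (fun l' => l1 k ≤ 2 * l1 l'),
      ((1 + ((l1 (k - l') : ℕ) : ℝ)) ^ 6)⁻¹ * ((1 + ((l1 l' : ℕ) : ℝ)) ^ 5)⁻¹ ≤ 32 * latC * (P ^ 5)⁻¹ := by
    calc ∑ l' ∈ F.filter (fun l' => l1 k ≤ 2 * l1 l'),
          ((1 + ((l1 (k - l') : ℕ) : ℝ)) ^ 6)⁻¹ * ((1 + ((l1 l' : ℕ) : ℝ)) ^ 5)⁻¹
        ≤ ∑ l' ∈ F.filter (fun l' => l1 k ≤ 2 * l1 l'),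
          ((1 + ((l1 (k - l') : ℕ) : ℝ)) ^ 6)⁻¹ * (32 * (P ^ 5)⁻¹) := by
          refine Finset.sum_le_sum fun l' hl' => ?_
          rw [Finset.mem_filter, hF, Finset.mem_filter] at hl'
          obtain ⟨⟨-, hm⟩, hk⟩ := hl'
          refine mul_le_mul_of_nonneg_left ?_ (by positivity)
          -- 2 (1 + |l'|₁) ≥ P
          have hb : P ≤ 2 * (1 + ((l1 l' : ℕ) : ℝ)) := by
            rw [hP]
            have : (max (l1 k) m : ℝ) ≤ 2 * (l1 l' : ℕ) := by
              refine max_le ?_ ?_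
              · exact_mod_cast hk
              · have : (m : ℝ) ≤ (l1 l' : ℕ) := by exact_mod_cast hm
                linarith
            push_cast at this ⊢
            linarith
          rw [show (32 : ℝ) * (P ^ 5)⁻¹ = ((P / 2) ^ 5)⁻¹ by field_simp; ring]
          exact inv_anti₀ (by positivity) (pow_le_pow_left₀ (by positivity) (by linarith) 5)
      _ = 32 * (P ^ 5)⁻¹ * ∑ l' ∈ F.filter (fun l' => l1 k ≤ 2 * l1 l'), ((1 + ((l1 (k - l') : ℕ) : ℝ)) ^ 6)⁻¹ := by
          rw [Finset.mul_sum]; refine Finset.sum_congr rfl fun _ _ => by ring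
      _ ≤ 32 * (P ^ 5)⁻¹ * latC :=
          mul_le_mul_of_nonneg_left (latticeSum_shift_le _ k) (by positivity)
      _ = 32 * latC * (P ^ 5)⁻¹ := by ring
  -- region 2
  have h2 : ∑ l' ∈ F.filter (fun l' => ¬ l1 k ≤ 2 * l1 l'),
      ((1 + ((l1 (k - l') : ℕ) : ℝ)) ^ 6)⁻¹ * ((1 + ((l1 l' : ℕ) : ℝ)) ^ 5)⁻¹ ≤ 64 * latC * (P ^ 5)⁻¹ := by
    calc ∑ l' ∈ F.filter (fun l' => ¬ l1 k ≤ 2 * l1 l'),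
          ((1 + ((l1 (k - l') : ℕ) : ℝ)) ^ 6)⁻¹ * ((1 + ((l1 l' : ℕ) : ℝ)) ^ 5)⁻¹
        ≤ ∑ l' ∈ F.filter (fun l' => ¬ l1 k ≤ 2 * l1 l'),
          (64 * (P ^ 5)⁻¹) * ((1 + ((l1 l' : ℕ) : ℝ)) ^ 6)⁻¹ := by
          refine Finset.sum_le_sum fun l' hl' => ?_
          rw [Finset.mem_filter, hF, Finset.mem_filter] at hl'
          obtain ⟨⟨-, hm⟩, hk⟩ := hl'
          push Not at hk
          -- here ρ = |k|₁, |k - l'|₁ > |k|₁ / 2 and |l'|₁ ≤ ρ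
          have hρ : max (l1 k) m = l1 k := max_eq_left (by omega)
          have hkl : l1 k ≤ l1 (k - l') + l1 l' := l1_le_l1_sub_add k l'
          have ha : P ≤ 2 * (1 + ((l1 (k - l') : ℕ) : ℝ)) := by
            rw [hP, hρ]
            have : l1 k + 1 ≤ 2 * l1 (k - l') + 2 := by omega
            have : ((l1 k : ℕ) : ℝ) + 1 ≤ 2 * ((l1 (k - l') : ℕ) : ℝ) + 2 := by exact_mod_cast this
            linarith
          have hb : ((l1 l' : ℕ) : ℝ) + 1 ≤ P := by
            rw [hP, hρ]
            have : l1 l' + 1 ≤ 1 + l1 k := by omega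
            exact_mod_cast this
          set a : ℝ := 1 + ((l1 (k - l') : ℕ) : ℝ)
          set b : ℝ := 1 + ((l1 l' : ℕ) : ℝ)
          have ha0 : 0 < a := by positivity
          have hb0 : 0 < b := by positivity
          have e1 : (a ^ 6)⁻¹ ≤ 64 * (P ^ 6)⁻¹ := by
            rw [show (64 : ℝ) * (P ^ 6)⁻¹ = ((P / 2) ^ 6)⁻¹ by field_simp; ring]
            exact inv_anti₀ (by positivity) (pow_le_pow_left₀ (by positivity) (by linarith) 6)
          have e2 : (b ^ 5)⁻¹ ≤ P * (b ^ 6)⁻¹ := by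
            rw [le_mul_inv_iff₀ (by positivity)]
            calc (b ^ 5)⁻¹ * b ^ 6 = b := by field_simp
              _ ≤ P := by linarith
          calc (a ^ 6)⁻¹ * (b ^ 5)⁻¹ ≤ (64 * (P ^ 6)⁻¹) * (P * (b ^ 6)⁻¹) := by gcongr
            _ = 64 * (P ^ 5)⁻¹ * (b ^ 6)⁻¹ := by field_simp
      _ = 64 * (P ^ 5)⁻¹ * ∑ l' ∈ F.filter (fun l' => ¬ l1 k ≤ 2 * l1 l'), ((1 + ((l1 l' : ℕ) : ℝ)) ^ 6)⁻¹ := by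
          rw [Finset.mul_sum]
      _ ≤ 64 * (P ^ 5)⁻¹ * latC := mul_le_mul_of_nonneg_left (latticeSum_le _) (by positivity)
      _ = 64 * latC * (P ^ 5)⁻¹ := by ring
  linarith

/-! ## §4 The convection symbol against the profile box -/

/-- **Norm of the convection symbol**: `‖B(c,c')_k‖ ≤ 2π ∑_{l'∈S} ‖c (k-l')‖ |l'|₁ ‖c' l'‖` (the `l`-sum collapses
on `l = k - l'`; dropping the constraint `k - l' ∈ S` only enlarges the bound). [folklore] -/
theorem norm_convectionCoeff_le (S : Finset (Fin 3 → ℤ)) (c c' : (Fin 3 → ℤ) → EuclideanSpace ℂ (Fin 3))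
    (k : Fin 3 → ℤ) :
    ‖convectionCoeff S c c' k‖ ≤ 2 * Real.pi * ∑ l' ∈ S, ‖c (k - l')‖ * ((l1 l' : ℕ) : ℝ) * ‖c' l'‖ := by
  classical
  rw [convectionCoeff_def]
  calc ‖∑ l ∈ S, ∑ m ∈ S, (if l + m = k then (2 * Real.pi * Complex.I * ∑ j, c l j * ((m j : ℤ) : ℂ)) • c' m else 0)‖
      ≤ ∑ l ∈ S, ‖∑ m ∈ S, (if l + m = k then (2 * Real.pi * Complex.I * ∑ j, c l j * ((m j : ℤ) : ℂ)) • c' m else 0)‖ :=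
        norm_sum_le _ _
    _ ≤ ∑ l ∈ S, ∑ m ∈ S, ‖(if l + m = k then (2 * Real.pi * Complex.I * ∑ j, c l j * ((m j : ℤ) : ℂ)) • c' m else 0)‖ :=
        Finset.sum_le_sum fun l _ => norm_sum_le _ _
    _ ≤ ∑ l ∈ S, ∑ m ∈ S, (if l = k - m then 2 * Real.pi * (‖c l‖ * ((l1 m : ℕ) : ℝ) * ‖c' m‖) else 0) := by
        refine Finset.sum_le_sum fun l _ => Finset.sum_le_sum fun m _ => ?_
        by_cases h : l + m = k
        · have h' : l = k - m := by rw [← h]; abel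
          rw [if_pos h, if_pos h', norm_smul]
          have hs : ‖2 * (Real.pi : ℂ) * Complex.I * ∑ j, c l j * ((m j : ℤ) : ℂ)‖ ≤ 2 * Real.pi * (‖c l‖ * ((l1 m : ℕ) : ℝ)) := by
            rw [norm_mul, norm_mul, norm_mul, Complex.norm_I, mul_one, Complex.norm_real, Real.norm_eq_abs,
              abs_of_pos Real.pi_pos, Complex.norm_ofNat]
            exact mul_le_mul_of_nonneg_left (norm_sum_mul_le (c l) m) (by positivity)
          calc ‖2 * (Real.pi : ℂ) * Complex.I * ∑ j, c l j * ((m j : ℤ) : ℂ)‖ * ‖c' m‖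
              ≤ 2 * Real.pi * (‖c l‖ * ((l1 m : ℕ) : ℝ)) * ‖c' m‖ := mul_le_mul_of_nonneg_right hs (norm_nonneg _)
            _ = 2 * Real.pi * (‖c l‖ * ((l1 m : ℕ) : ℝ) * ‖c' m‖) := by ring
        · have h' : ¬ l = k - m := fun h' => h (by rw [h']; abel)
          rw [if_neg h, if_neg h', norm_zero]
    _ = ∑ m ∈ S, ∑ l ∈ S, (if l = k - m then 2 * Real.pi * (‖c l‖ * ((l1 m : ℕ) : ℝ) * ‖c' m‖) else 0) := Finset.sum_comm
    _ = ∑ m ∈ S, (if k - m ∈ S then 2 * Real.pi * (‖c (k - m)‖ * ((l1 m : ℕ) : ℝ) * ‖c' m‖) else 0) := by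
        refine Finset.sum_congr rfl fun m _ => ?_
        rw [Finset.sum_ite_eq' S (k - m) (fun l => 2 * Real.pi * (‖c l‖ * ((l1 m : ℕ) : ℝ) * ‖c' m‖))]
    _ ≤ ∑ m ∈ S, 2 * Real.pi * (‖c (k - m)‖ * ((l1 m : ℕ) : ℝ) * ‖c' m‖) := by
        refine Finset.sum_le_sum fun m _ => ?_
        split_ifs
        · exact le_rfl
        · positivity
    _ = 2 * Real.pi * ∑ l' ∈ S, ‖c (k - l')‖ * ((l1 l' : ℕ) : ℝ) * ‖c' l'‖ := by rw [Finset.mul_sum]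

/-- **The convection symbol inside the profile box**: if `‖c j‖ ≤ prof(j)` for all `j` then
`‖B(c,c)_k‖ ≤ 192 π C · A (1+|k|₁) · prof(k)`. -/
theorem norm_convectionCoeff_le_of_box {A θ : ℝ} (hA : 0 ≤ A) (hθ : 0 ≤ θ) (hθ1 : θ ≤ 1)
    (S : Finset (Fin 3 → ℤ)) (c : (Fin 3 → ℤ) → EuclideanSpace ℂ (Fin 3)) (hc : ∀ j, ‖c j‖ ≤ prof A θ j)
    (k : Fin 3 → ℤ) :
    ‖convectionCoeff S c c k‖ ≤ 192 * Real.pi * latC * (A * (1 + ((l1 k : ℕ) : ℝ)) * prof A θ k) := by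
  classical
  have hsum : ∑ l' ∈ S, ‖c (k - l')‖ * ((l1 l' : ℕ) : ℝ) * ‖c l'‖ ≤
      A ^ 2 * θ ^ (l1 k) * (96 * latC * ((1 + ((l1 k : ℕ) : ℝ)) ^ 5)⁻¹) := by
    calc ∑ l' ∈ S, ‖c (k - l')‖ * ((l1 l' : ℕ) : ℝ) * ‖c l'‖
        ≤ ∑ l' ∈ S, prof A θ (k - l') * ((l1 l' : ℕ) : ℝ) * prof A θ l' := by
          refine Finset.sum_le_sum fun l' _ => ?_
          have h1 := hc (k - l'); have h2 := hc l'
          have : 0 ≤ prof A θ (k - l') := prof_nonneg hA hθ _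
          gcongr
      _ ≤ ∑ l' ∈ S, A ^ 2 * θ ^ (l1 k) * (((1 + ((l1 (k - l') : ℕ) : ℝ)) ^ 6)⁻¹ * ((1 + ((l1 l' : ℕ) : ℝ)) ^ 5)⁻¹) :=
          Finset.sum_le_sum fun l' _ => prof_mul_l1_mul_prof_le hA hθ hθ1 k l'
      _ = A ^ 2 * θ ^ (l1 k) * ∑ l' ∈ S.filter (fun l' => 0 ≤ l1 l'),
            ((1 + ((l1 (k - l') : ℕ) : ℝ)) ^ 6)⁻¹ * ((1 + ((l1 l' : ℕ) : ℝ)) ^ 5)⁻¹ := by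
          rw [Finset.filter_true_of_mem fun l' _ => Nat.zero_le (l1 l'), Finset.mul_sum]
      _ ≤ A ^ 2 * θ ^ (l1 k) * (96 * latC * ((1 + ((max (l1 k) 0 : ℕ) : ℝ)) ^ 5)⁻¹) :=
          mul_le_mul_of_nonneg_left (keySum_le S k 0) (by positivity)
      _ = A ^ 2 * θ ^ (l1 k) * (96 * latC * ((1 + ((l1 k : ℕ) : ℝ)) ^ 5)⁻¹) := by rw [Nat.max_eq_left (Nat.zero_le _)]
  calc ‖convectionCoeff S c c k‖ ≤ 2 * Real.pi * ∑ l' ∈ S, ‖c (k - l')‖ * ((l1 l' : ℕ) : ℝ) * ‖c l'‖ :=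
        norm_convectionCoeff_le S c c k
    _ ≤ 2 * Real.pi * (A ^ 2 * θ ^ (l1 k) * (96 * latC * ((1 + ((l1 k : ℕ) : ℝ)) ^ 5)⁻¹)) :=
        mul_le_mul_of_nonneg_left hsum (by positivity)
    _ = 192 * Real.pi * latC * (A * (1 + ((l1 k : ℕ) : ℝ)) * prof A θ k) := by
        rw [prof_eq]
        field_simp
        ring

/-! ## §5 Clause (i): per-mode tail entrance -/

/-- Real part of `⟪x, -a • x + L⟫` for a real scalar `a`. -/
theorem re_inner_neg_smul_add (x L : EuclideanSpace ℂ (Fin 3)) (a : ℝ) :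
    (inner ℂ x (-(((a : ℝ) : ℂ) • x) + L)).re = -a * ‖x‖ ^ 2 + (inner ℂ x L).re := by
  rw [inner_add_right, inner_neg_right, inner_smul_right, Complex.add_re, Complex.neg_re, Complex.mul_re,
    Complex.ofReal_re, Complex.ofReal_im, zero_mul, sub_zero]
  have h := inner_self_eq_norm_sq (𝕜 := ℂ) x
  rw [RCLike.re_to_complex] at h
  rw [h]
  ring

/-- Box bounds extend to the zero extension. -/
theorem norm_coeffExt_le_prof {A θ : ℝ} (hA : 0 ≤ A) (hθ : 0 ≤ θ) {S : Finset (Fin 3 → ℤ)}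
    (x : ↥S → EuclideanSpace ℂ (Fin 3)) (hx : ∀ l : ↥S, ‖x l‖ ≤ prof A θ l) (j : Fin 3 → ℤ) :
    ‖coeffExt S x j‖ ≤ prof A θ j := by
  by_cases hj : j ∈ S
  · rw [coeffExt_of_mem x hj]; exact hx ⟨j, hj⟩
  · rw [coeffExt_of_not_mem x hj, norm_zero]; exact prof_nonneg hA hθ j

/-- **Clause (i), quantitative form.** For a mode `k` with no force on it, sitting on its box face `‖x k‖ = prof(k)`, all
modes inside the box: `Re⟪x k, (galerkinRHS ν g x) k⟫ ≤ prof(k)² (192 π C A (1+|k|₁) − 4π² ν |k|₂²)`. -/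
theorem re_inner_field_le {ν A θ : ℝ} (hA : 0 < A) (hθ : 0 < θ) (hθ1 : θ ≤ 1) {N : ℕ}
    (x g : ↥(freqBall N : Finset (Fin 3 → ℤ)) → EuclideanSpace ℂ (Fin 3))
    (hx : ∀ l : ↥(freqBall N : Finset (Fin 3 → ℤ)), ‖x l‖ ≤ prof A θ l)
    (k : ↥(freqBall N : Finset (Fin 3 → ℤ))) (hg : g k = 0) (hnorm : ‖x k‖ = prof A θ k) :
    (inner ℂ (x k) (galerkinRHS (freqBall N : Finset (Fin 3 → ℤ)) ν g x k)).re ≤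
      prof A θ k ^ 2 * (192 * Real.pi * latC * (A * (1 + ((l1 (k : Fin 3 → ℤ) : ℕ) : ℝ))) -
        ν * (4 * Real.pi ^ 2 * freqNormSq (k : Fin 3 → ℤ))) := by
  set L : ℝ := ((l1 (k : Fin 3 → ℤ) : ℕ) : ℝ) with hL
  set Q : ℝ := freqNormSq (k : Fin 3 → ℤ) with hQ
  set p : ℝ := prof A θ k with hp
  have hp0 : 0 < p := prof_pos hA hθ _
  rw [galerkinRHS_apply, galerkinField_def, coeffExt_coe, coeffExt_coe, hg, re_inner_neg_smul_add]
  have hconv : ‖convectionCoeff (freqBall N : Finset (Fin 3 → ℤ)) (coeffExt (freqBall N : Finset (Fin 3 → ℤ)) x)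
      (coeffExt (freqBall N : Finset (Fin 3 → ℤ)) x) (k : Fin 3 → ℤ)‖ ≤ 192 * Real.pi * latC * (A * (1 + L) * p) :=
    norm_convectionCoeff_le_of_box hA.le hθ.le hθ1 _ _ (norm_coeffExt_le_prof hA.le hθ.le x hx) k
  have hLer : (inner ℂ (x k) (leraySym (k : Fin 3 → ℤ)
      (0 - convectionCoeff (freqBall N : Finset (Fin 3 → ℤ)) (coeffExt (freqBall N : Finset (Fin 3 → ℤ)) x)
        (coeffExt (freqBall N : Finset (Fin 3 → ℤ)) x) (k : Fin 3 → ℤ)))).re ≤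
      p * (192 * Real.pi * latC * (A * (1 + L) * p)) := by
    refine ((Complex.re_le_norm _).trans (norm_inner_le_norm _ _)).trans ?_
    rw [hnorm]
    refine mul_le_mul_of_nonneg_left ((norm_leraySym_le _ _).trans ?_) hp0.le
    rwa [zero_sub, norm_neg]
  rw [hnorm]
  have h5 : p * (192 * Real.pi * latC * (A * (1 + L) * p)) = p ^ 2 * (192 * Real.pi * latC * (A * (1 + L))) := by ring
  have h7 : -(ν * (4 * Real.pi ^ 2 * Q)) * p ^ 2 + p ^ 2 * (192 * Real.pi * latC * (A * (1 + L))) =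
      p ^ 2 * (192 * Real.pi * latC * (A * (1 + L)) - ν * (4 * Real.pi ^ 2 * Q)) := by ring
  linarith [hLer, h5, h7]

/-- The sweeping-scale arithmetic: `288 C A < π ν (m+1)` and `m² < |k|²` give `192 π C A (1+|k|₁) < 4 π² ν |k|₂²`. -/
theorem sweeping_ineq {ν A : ℝ} (hν : 0 < ν) (hA : 0 < A) {m : ℕ} (hth : 288 * latC * A < Real.pi * ν * ((m : ℝ) + 1))
    {k : Fin 3 → ℤ} (hk : ((m : ℕ) : ℝ) ^ 2 < freqNormSq k) :
    192 * Real.pi * latC * (A * (1 + ((l1 k : ℕ) : ℝ))) < ν * (4 * Real.pi ^ 2 * freqNormSq k) := by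
  set L : ℝ := ((l1 k : ℕ) : ℝ) with hL
  set Q : ℝ := freqNormSq k with hQ
  have hpi : 0 < Real.pi := Real.pi_pos
  have hC : 0 ≤ latC := latC_nonneg
  have hL1 : (m : ℝ) + 1 ≤ L := by
    have := succ_le_l1_of_sq_lt hk
    rw [hL]; exact_mod_cast this
  have hL0 : 1 ≤ L := le_trans (by linarith [Nat.cast_nonneg (α := ℝ) m]) hL1
  have hQ3 : L ^ 2 ≤ 3 * Q := l1_sq_le_three_mul_freqNormSq _
  have h1 : 288 * latC * A * L < Real.pi * ν * L ^ 2 := by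
    have h1a : 288 * latC * A * L < Real.pi * ν * ((m : ℝ) + 1) * L := mul_lt_mul_of_pos_right hth (by linarith)
    have h1b : Real.pi * ν * ((m : ℝ) + 1) * L ≤ Real.pi * ν * L * L :=
      mul_le_mul_of_nonneg_right (mul_le_mul_of_nonneg_left hL1 (by positivity)) (by linarith)
    nlinarith
  calc 192 * Real.pi * latC * (A * (1 + L)) ≤ 192 * Real.pi * latC * (A * (2 * L)) := by gcongr; linarith
    _ = (4 * Real.pi / 3) * (288 * latC * A * L) := by ring
    _ < (4 * Real.pi / 3) * (Real.pi * ν * L ^ 2) := by gcongr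
    _ = (4 * Real.pi ^ 2 * ν / 3) * L ^ 2 := by ring
    _ ≤ (4 * Real.pi ^ 2 * ν / 3) * (3 * Q) := by gcongr
    _ = ν * (4 * Real.pi ^ 2 * Q) := by ring

/-- **Clause (i).** Beyond the sweeping scale (`288 C A < π ν (m+1)`), a tail mode `m² < |k|²` with no force on it
sitting on its box face `‖x k‖ = prof(k)`, with all modes inside the box, is a strict ENTRANCE face:
`Re⟪x k, (galerkinRHS ν g x) k⟫ < 0`. -/
theorem entrance_clause {ν A θ : ℝ} (hν : 0 < ν) (hA : 0 < A) (hθ : 0 < θ) (hθ1 : θ ≤ 1) {N m : ℕ}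
    (hth : 288 * latC * A < Real.pi * ν * ((m : ℝ) + 1))
    (x g : ↥(freqBall N : Finset (Fin 3 → ℤ)) → EuclideanSpace ℂ (Fin 3))
    (hx : ∀ l : ↥(freqBall N : Finset (Fin 3 → ℤ)), ‖x l‖ ≤ prof A θ l)
    (k : ↥(freqBall N : Finset (Fin 3 → ℤ))) (hk : ((m : ℕ) : ℝ) ^ 2 < freqNormSq (k : Fin 3 → ℤ))
    (hg : g k = 0) (hnorm : ‖x k‖ = prof A θ k) :
    (inner ℂ (x k) (galerkinRHS (freqBall N : Finset (Fin 3 → ℤ)) ν g x k)).re < 0 := by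
  have h1 := re_inner_field_le (ν := ν) hA hθ hθ1 x g hx k hg hnorm
  have h2 := sweeping_ineq hν hA hth hk
  have hp0 : 0 < prof A θ k ^ 2 := pow_pos (prof_pos hA hθ _) 2
  have h3 : prof A θ k ^ 2 * (192 * Real.pi * latC * (A * (1 + ((l1 (k : Fin 3 → ℤ) : ℕ) : ℝ))) -
      ν * (4 * Real.pi ^ 2 * freqNormSq (k : Fin 3 → ℤ))) < 0 :=
    mul_neg_of_pos_of_neg hp0 (by linarith)
  linarith

/-! ## §6 Clauses (iii)/(iv): the tail of the box is small -/

/-- One profile value in the tail, squared: `prof(k)² ≤ A² θ^{2m} (1+|k|₁)^{-6}` when `m ≤ |k|₁`. -/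
theorem prof_sq_le_of_le {A θ : ℝ} (_hA : 0 ≤ A) (hθ : 0 ≤ θ) (hθ1 : θ ≤ 1) {m : ℕ} {k : Fin 3 → ℤ}
    (hm : m ≤ l1 k) : prof A θ k ^ 2 ≤ A ^ 2 * θ ^ (2 * m) * ((1 + ((l1 k : ℕ) : ℝ)) ^ 6)⁻¹ := by
  rw [prof_eq]
  set Lr : ℝ := 1 + ((l1 k : ℕ) : ℝ) with hLr
  have hL0 : 1 ≤ Lr := by rw [hLr]; linarith [Nat.cast_nonneg (α := ℝ) (l1 k)]
  have hpow : θ ^ (l1 k) ≤ θ ^ m := pow_le_pow_of_le_one hθ hθ1 hm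
  have e : (A * θ ^ l1 k / Lr ^ 6) ^ 2 = A ^ 2 * (θ ^ l1 k) ^ 2 * ((Lr ^ 6)⁻¹ * (Lr ^ 6)⁻¹) := by
    field_simp
  rw [e, show θ ^ (2 * m) = (θ ^ m) ^ 2 by rw [mul_comm, pow_mul]]
  have h6 : (Lr ^ 6)⁻¹ ≤ 1 := inv_le_one_of_one_le₀ (one_le_pow₀ hL0)
  have h6' : 0 ≤ (Lr ^ 6)⁻¹ := by positivity
  calc A ^ 2 * (θ ^ l1 k) ^ 2 * ((Lr ^ 6)⁻¹ * (Lr ^ 6)⁻¹) ≤ A ^ 2 * (θ ^ m) ^ 2 * ((Lr ^ 6)⁻¹ * 1) := by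
        gcongr
    _ = A ^ 2 * (θ ^ m) ^ 2 * (Lr ^ 6)⁻¹ := by ring

/-- The enstrophy weight costs two powers: `|k|₂² prof(k)² ≤ A² θ^{2m} (1+|k|₁)^{-6}` when `m ≤ |k|₁`. -/
theorem freqNormSq_mul_prof_sq_le_of_le {A θ : ℝ} (_hA : 0 ≤ A) (hθ : 0 ≤ θ) (hθ1 : θ ≤ 1) {m : ℕ}
    {k : Fin 3 → ℤ} (hm : m ≤ l1 k) :
    freqNormSq k * prof A θ k ^ 2 ≤ A ^ 2 * θ ^ (2 * m) * ((1 + ((l1 k : ℕ) : ℝ)) ^ 6)⁻¹ := by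
  rw [prof_eq]
  set Lr : ℝ := 1 + ((l1 k : ℕ) : ℝ) with hLr
  have hL0 : 1 ≤ Lr := by rw [hLr]; linarith [Nat.cast_nonneg (α := ℝ) (l1 k)]
  have hQ : freqNormSq k ≤ Lr ^ 2 := by
    refine (freqNormSq_le_l1_sq k).trans ?_
    rw [hLr]; nlinarith [Nat.cast_nonneg (α := ℝ) (l1 k)]
  have hpow : θ ^ (l1 k) ≤ θ ^ m := pow_le_pow_of_le_one hθ hθ1 hm
  have e : (A * θ ^ l1 k / Lr ^ 6) ^ 2 = A ^ 2 * (θ ^ l1 k) ^ 2 * ((Lr ^ 2)⁻¹ * ((Lr ^ 4)⁻¹ * (Lr ^ 6)⁻¹)) := by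
    field_simp
  rw [e, show θ ^ (2 * m) = (θ ^ m) ^ 2 by rw [mul_comm, pow_mul]]
  have h4 : (Lr ^ 4)⁻¹ ≤ 1 := inv_le_one_of_one_le₀ (one_le_pow₀ hL0)
  have hQ0 : 0 ≤ freqNormSq k := by rw [freqNormSq]; positivity
  calc freqNormSq k * (A ^ 2 * (θ ^ l1 k) ^ 2 * ((Lr ^ 2)⁻¹ * ((Lr ^ 4)⁻¹ * (Lr ^ 6)⁻¹)))
      = (freqNormSq k * (Lr ^ 2)⁻¹) * (A ^ 2 * (θ ^ l1 k) ^ 2 * ((Lr ^ 4)⁻¹ * (Lr ^ 6)⁻¹)) := by ring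
    _ ≤ 1 * (A ^ 2 * (θ ^ m) ^ 2 * (1 * (Lr ^ 6)⁻¹)) := by
        gcongr
        rw [mul_inv_le_iff₀ (by positivity), one_mul]; exact hQ
    _ = A ^ 2 * (θ ^ m) ^ 2 * (Lr ^ 6)⁻¹ := by ring

theorem filter_freqBall_le {m N : ℕ} (hmN : m ≤ N) :
    (freqBall N : Finset (Fin 3 → ℤ)).filter (fun k => freqNormSq k ≤ ((m : ℕ) : ℝ) ^ 2) = freqBall m := by
  ext k
  simp only [Finset.mem_filter, mem_freqBall]
  exact ⟨fun hk => hk.2, fun hk => ⟨hk.trans (by gcongr), hk⟩⟩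

/-- `∑_{|k| ≤ N} g = ∑_{|k| ≤ m} g + ∑_{|k| ≤ N} 𝟙{m² < |k|²} g` for `m ≤ N`. [folklore] -/
theorem sum_freqBall_split {m N : ℕ} (hmN : m ≤ N) (g : (Fin 3 → ℤ) → ℝ) :
    ∑ k : ↥(freqBall N : Finset (Fin 3 → ℤ)), g k =
      ∑ l : ↥(freqBall m : Finset (Fin 3 → ℤ)), g l +
        ∑ k : ↥(freqBall N : Finset (Fin 3 → ℤ)), (if ((m : ℕ) : ℝ) ^ 2 < freqNormSq (k : Fin 3 → ℤ) then g k else 0) := by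
  rw [Finset.sum_coe_sort (freqBall N) g, Finset.sum_coe_sort (freqBall m) g,
    Finset.sum_coe_sort (freqBall N) (fun k => if ((m : ℕ) : ℝ) ^ 2 < freqNormSq k then g k else 0),
    ← Finset.sum_filter, ← filter_freqBall_le hmN,
    ← Finset.sum_filter_add_sum_filter_not (freqBall N) (fun k => freqNormSq k ≤ ((m : ℕ) : ℝ) ^ 2) g]
  congr 1
  refine Finset.sum_congr ?_ fun _ _ => rfl
  ext k
  simp only [Finset.mem_filter, not_le]

/-- Tail energy term of the box. -/
theorem tail_energy_le {A θ : ℝ} (hA : 0 ≤ A) (hθ : 0 ≤ θ) (hθ1 : θ ≤ 1) {m N : ℕ}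
    (x : ↥(freqBall N : Finset (Fin 3 → ℤ)) → EuclideanSpace ℂ (Fin 3))
    (hx : ∀ l : ↥(freqBall N : Finset (Fin 3 → ℤ)), ‖x l‖ ≤ prof A θ l) :
    ∑ k : ↥(freqBall N : Finset (Fin 3 → ℤ)),
        (if ((m : ℕ) : ℝ) ^ 2 < freqNormSq (k : Fin 3 → ℤ) then ‖x k‖ ^ 2 else 0) ≤ A ^ 2 * θ ^ (2 * m) * latC := by
  classical
  have step : ∀ k : ↥(freqBall N : Finset (Fin 3 → ℤ)),
      (if ((m : ℕ) : ℝ) ^ 2 < freqNormSq (k : Fin 3 → ℤ) then ‖x k‖ ^ 2 else 0) ≤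
        A ^ 2 * θ ^ (2 * m) * ((1 + ((l1 (k : Fin 3 → ℤ) : ℕ) : ℝ)) ^ 6)⁻¹ := by
    intro k
    split_ifs with hk
    · have hm : m ≤ l1 (k : Fin 3 → ℤ) := (Nat.le_succ m).trans (succ_le_l1_of_sq_lt hk)
      exact (pow_le_pow_left₀ (norm_nonneg _) (hx k) 2).trans (prof_sq_le_of_le hA hθ hθ1 hm)
    · positivity
  refine (Finset.sum_le_sum fun k _ => step k).trans ?_
  rw [← Finset.mul_sum, Finset.sum_coe_sort (freqBall N : Finset (Fin 3 → ℤ))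
    (fun k => ((1 + ((l1 k : ℕ) : ℝ)) ^ 6)⁻¹)]
  exact mul_le_mul_of_nonneg_left (latticeSum_le _) (by positivity)

/-- Tail enstrophy term of the box. -/
theorem tail_enstrophy_le {A θ : ℝ} (hA : 0 ≤ A) (hθ : 0 ≤ θ) (hθ1 : θ ≤ 1) {m N : ℕ}
    (x : ↥(freqBall N : Finset (Fin 3 → ℤ)) → EuclideanSpace ℂ (Fin 3))
    (hx : ∀ l : ↥(freqBall N : Finset (Fin 3 → ℤ)), ‖x l‖ ≤ prof A θ l) :
    ∑ k : ↥(freqBall N : Finset (Fin 3 → ℤ)),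
        (if ((m : ℕ) : ℝ) ^ 2 < freqNormSq (k : Fin 3 → ℤ) then freqNormSq (k : Fin 3 → ℤ) * ‖x k‖ ^ 2 else 0) ≤
      A ^ 2 * θ ^ (2 * m) * latC := by
  classical
  have step : ∀ k : ↥(freqBall N : Finset (Fin 3 → ℤ)),
      (if ((m : ℕ) : ℝ) ^ 2 < freqNormSq (k : Fin 3 → ℤ) then freqNormSq (k : Fin 3 → ℤ) * ‖x k‖ ^ 2 else 0) ≤
        A ^ 2 * θ ^ (2 * m) * ((1 + ((l1 (k : Fin 3 → ℤ) : ℕ) : ℝ)) ^ 6)⁻¹ := by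
    intro k
    split_ifs with hk
    · have hm : m ≤ l1 (k : Fin 3 → ℤ) := (Nat.le_succ m).trans (succ_le_l1_of_sq_lt hk)
      have hQ0 : 0 ≤ freqNormSq (k : Fin 3 → ℤ) := by rw [freqNormSq]; positivity
      exact (mul_le_mul_of_nonneg_left (pow_le_pow_left₀ (norm_nonneg _) (hx k) 2) hQ0).trans
        (freqNormSq_mul_prof_sq_le_of_le hA hθ hθ1 hm)
    · positivity
  refine (Finset.sum_le_sum fun k _ => step k).trans ?_
  rw [← Finset.mul_sum, Finset.sum_coe_sort (freqBall N : Finset (Fin 3 → ℤ))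
    (fun k => ((1 + ((l1 k : ℕ) : ℝ)) ^ 6)⁻¹)]
  exact mul_le_mul_of_nonneg_left (latticeSum_le _) (by positivity)

/-- **Clauses (iii)/(iv), quantitative form.** Inside the box, the energy and the enstrophy of order `N` exceed those
of the restriction to order `m ≤ N` by at most `½ A² θ^{2m} C` and `4π² A² θ^{2m} C`. -/
theorem tail_sums_le {A θ : ℝ} (hA : 0 ≤ A) (hθ : 0 ≤ θ) (hθ1 : θ ≤ 1) {m N : ℕ} (hmN : m ≤ N)
    (x : ↥(freqBall N : Finset (Fin 3 → ℤ)) → EuclideanSpace ℂ (Fin 3))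
    (hx : ∀ l : ↥(freqBall N : Finset (Fin 3 → ℤ)), ‖x l‖ ≤ prof A θ l) :
    (2⁻¹ * ∑ k : ↥(freqBall N : Finset (Fin 3 → ℤ)), ‖x k‖ ^ 2 ≤
      2⁻¹ * ∑ l : ↥(freqBall m : Finset (Fin 3 → ℤ)), ‖coeffExt (freqBall N : Finset (Fin 3 → ℤ)) x (l : Fin 3 → ℤ)‖ ^ 2 +
        2⁻¹ * (A ^ 2 * θ ^ (2 * m) * latC)) ∧
    (4 * Real.pi ^ 2 * ∑ k : ↥(freqBall N : Finset (Fin 3 → ℤ)), freqNormSq (k : Fin 3 → ℤ) * ‖x k‖ ^ 2 ≤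
      4 * Real.pi ^ 2 * ∑ l : ↥(freqBall m : Finset (Fin 3 → ℤ)),
        freqNormSq (l : Fin 3 → ℤ) * ‖coeffExt (freqBall N : Finset (Fin 3 → ℤ)) x (l : Fin 3 → ℤ)‖ ^ 2 +
        4 * Real.pi ^ 2 * (A ^ 2 * θ ^ (2 * m) * latC)) := by
  have eE := sum_freqBall_split hmN (fun k => ‖coeffExt (freqBall N : Finset (Fin 3 → ℤ)) x k‖ ^ 2)
  have eZ := sum_freqBall_split hmN (fun k => freqNormSq k * ‖coeffExt (freqBall N : Finset (Fin 3 → ℤ)) x k‖ ^ 2)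
  simp only [coeffExt_coe] at eE eZ
  have tE := tail_energy_le (m := m) hA hθ hθ1 x hx
  have tZ := tail_enstrophy_le (m := m) hA hθ hθ1 x hx
  constructor
  · rw [eE, mul_add]
    linarith [mul_le_mul_of_nonneg_left tE (by norm_num : (0 : ℝ) ≤ 2⁻¹)]
  · rw [eZ, mul_add]
    linarith [mul_le_mul_of_nonneg_left tZ (by positivity : (0 : ℝ) ≤ 4 * Real.pi ^ 2)]

/-! ## §7 Clause (ii): the modewise low/tail coupling -/

/-- Enlarging the frequency set does not change the convection symbol of families vanishing off the smaller set. -/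
theorem convectionCoeff_subset_eq {S T : Finset (Fin 3 → ℤ)} (hST : S ⊆ T)
    (c c' : (Fin 3 → ℤ) → EuclideanSpace ℂ (Fin 3)) (hc : ∀ j ∉ S, c j = 0) (hc' : ∀ j ∉ S, c' j = 0)
    (k : Fin 3 → ℤ) : convectionCoeff S c c' k = convectionCoeff T c c' k := by
  classical
  rw [convectionCoeff_def, convectionCoeff_def]
  refine Finset.sum_subset hST (fun l _ hl => ?_) |>.symm.trans ?_ |>.symm
  · refine Finset.sum_eq_zero fun m _ => ?_
    simp [hc l hl]
  · refine (Finset.sum_congr rfl fun l _ => Finset.sum_subset hST fun m _ hm => ?_).symm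
    simp [hc' m hm]

/-- The `θ`-power of a pair one of whose members is beyond level `m`. -/
theorem pow_pair_le {θ : ℝ} (hθ : 0 ≤ θ) (hθ1 : θ ≤ 1) {m : ℕ} {k l' : Fin 3 → ℤ}
    (hm : m ≤ l1 (k - l') + l1 l') : θ ^ (l1 (k - l') + l1 l') ≤ θ ^ (max (l1 k) m) :=
  pow_le_pow_of_le_one hθ hθ1 (max_le (l1_le_l1_sub_add k l') hm)

/-- Term bound of type (B): the OUTSIDE member is `l'` (`m+1 ≤ |l'|₁`), carrying the `|l'|₁` weight:
`prof(k-l') |l'|₁ prof(l') ≤ A² θ^{max(|k|₁,m)} (1+|k-l'|₁)^{-6} (1+|l'|₁)^{-5}`. -/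
theorem termB_le {A θ : ℝ} (_hA : 0 ≤ A) (hθ : 0 ≤ θ) (hθ1 : θ ≤ 1) {m : ℕ} (k l' : Fin 3 → ℤ)
    (hl' : m + 1 ≤ l1 l') :
    prof A θ (k - l') * ((l1 l' : ℕ) : ℝ) * prof A θ l' ≤
      A ^ 2 * θ ^ (max (l1 k) m) * (((1 + ((l1 (k - l') : ℕ) : ℝ)) ^ 6)⁻¹ * ((1 + ((l1 l' : ℕ) : ℝ)) ^ 5)⁻¹) := by
  rw [prof_eq, prof_eq]
  have hpow : θ ^ (l1 (k - l')) * θ ^ (l1 l') ≤ θ ^ (max (l1 k) m) := by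
    rw [← pow_add]; exact pow_pair_le hθ hθ1 (by omega)
  set a : ℝ := 1 + ((l1 (k - l') : ℕ) : ℝ) with ha
  set b : ℝ := 1 + ((l1 l' : ℕ) : ℝ) with hb
  have ha0 : 0 < a := by rw [ha]; positivity
  have hb0 : 0 < b := by rw [hb]; positivity
  have hlb : ((l1 l' : ℕ) : ℝ) ≤ b := by rw [hb]; linarith
  have hθk : 0 ≤ θ ^ (max (l1 k) m) := pow_nonneg hθ _
  have lhs_eq : A * θ ^ l1 (k - l') / a ^ 6 * ((l1 l' : ℕ) : ℝ) * (A * θ ^ l1 l' / b ^ 6) =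
      A ^ 2 * (θ ^ l1 (k - l') * θ ^ l1 l') * ((a ^ 6)⁻¹ * (((l1 l' : ℕ) : ℝ) * (b ^ 6)⁻¹)) := by
    field_simp
  rw [lhs_eq]
  have h5 : ((l1 l' : ℕ) : ℝ) * (b ^ 6)⁻¹ ≤ (b ^ 5)⁻¹ := by
    rw [← div_eq_mul_inv, div_le_iff₀ (by positivity)]
    calc ((l1 l' : ℕ) : ℝ) ≤ b := hlb
      _ = (b ^ 5)⁻¹ * b ^ 6 := by field_simp
  gcongr

/-- Term bound of type (A): the OUTSIDE member is `k - l'` (`m+1 ≤ |k-l'|₁`) while `|k|₁ ≤ 2m`, so the weight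
`|l'|₁ ≤ |k|₁ + |k-l'|₁ ≤ 3(1+|k-l'|₁)` is paid by the outside member:
`prof(k-l') |l'|₁ prof(l') ≤ 3 A² θ^{max(|k|₁,m)} (1+|k-l'|₁)^{-5} (1+|l'|₁)^{-6}`. -/
theorem termA_le {A θ : ℝ} (_hA : 0 ≤ A) (hθ : 0 ≤ θ) (hθ1 : θ ≤ 1) {m : ℕ} (k l' : Fin 3 → ℤ)
    (hk : l1 k ≤ 2 * m) (hl : m + 1 ≤ l1 (k - l')) :
    prof A θ (k - l') * ((l1 l' : ℕ) : ℝ) * prof A θ l' ≤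
      3 * (A ^ 2 * θ ^ (max (l1 k) m) * (((1 + ((l1 (k - l') : ℕ) : ℝ)) ^ 5)⁻¹ * ((1 + ((l1 l' : ℕ) : ℝ)) ^ 6)⁻¹)) := by
  rw [prof_eq, prof_eq]
  have hpow : θ ^ (l1 (k - l')) * θ ^ (l1 l') ≤ θ ^ (max (l1 k) m) := by
    rw [← pow_add]; exact pow_pair_le hθ hθ1 (by omega)
  have hw : l1 l' ≤ 3 * (1 + l1 (k - l')) := by
    have h1 : l1 l' ≤ l1 (l' - k) + l1 k := l1_le_l1_sub_add l' k
    have h2 : l1 (l' - k) = l1 (k - l') := by rw [← l1_neg, neg_sub]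
    omega
  set a : ℝ := 1 + ((l1 (k - l') : ℕ) : ℝ) with ha
  set b : ℝ := 1 + ((l1 l' : ℕ) : ℝ) with hb
  have ha0 : 0 < a := by rw [ha]; positivity
  have hb0 : 0 < b := by rw [hb]; positivity
  have hla : ((l1 l' : ℕ) : ℝ) ≤ 3 * a := by
    rw [ha]; exact_mod_cast hw
  have hθk : 0 ≤ θ ^ (max (l1 k) m) := pow_nonneg hθ _
  have lhs_eq : A * θ ^ l1 (k - l') / a ^ 6 * ((l1 l' : ℕ) : ℝ) * (A * θ ^ l1 l' / b ^ 6) =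
      A ^ 2 * (θ ^ l1 (k - l') * θ ^ l1 l') * ((((l1 l' : ℕ) : ℝ) * (a ^ 6)⁻¹) * (b ^ 6)⁻¹) := by
    field_simp
  have rhs_eq : 3 * (A ^ 2 * θ ^ (max (l1 k) m) * ((a ^ 5)⁻¹ * (b ^ 6)⁻¹)) =
      A ^ 2 * θ ^ (max (l1 k) m) * ((3 * (a ^ 5)⁻¹) * (b ^ 6)⁻¹) := by ring
  rw [lhs_eq, rhs_eq]
  have h5 : ((l1 l' : ℕ) : ℝ) * (a ^ 6)⁻¹ ≤ 3 * (a ^ 5)⁻¹ := by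
    rw [← div_eq_mul_inv, div_le_iff₀ (by positivity)]
    calc ((l1 l' : ℕ) : ℝ) ≤ 3 * a := hla
      _ = 3 * (a ^ 5)⁻¹ * a ^ 6 := by field_simp
  gcongr

/-- **Clause (ii).** For `m ≤ N`, `x` of order `N` inside the box, `k` of order `m`, and the sweeping condition
`768 π C A ≤ ν (m + 1)`: the `k`-th component of the order-`N` field differs from that of the order-`m` field of the
restriction by at most the coupling majorant `ν A θ^{max(|k|₁,m)} (1+max(|k|₁,m))^{-4}`. -/
theorem coupling_clause {ν A θ : ℝ} (hν : 0 < ν) (hA : 0 < A) (hθ : 0 < θ) (hθ1 : θ ≤ 1) {m N : ℕ}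
    (hmN : m ≤ N) (hth : 768 * Real.pi * latC * A ≤ ν * ((m : ℝ) + 1))
    (x : ↥(freqBall N : Finset (Fin 3 → ℤ)) → EuclideanSpace ℂ (Fin 3))
    (hx : ∀ l : ↥(freqBall N : Finset (Fin 3 → ℤ)), ‖x l‖ ≤ prof A θ l)
    (f : UnitAddTorus (Fin 3) → EuclideanSpace ℝ (Fin 3)) (k : ↥(freqBall m : Finset (Fin 3 → ℤ))) :
    ‖coeffExt (freqBall N : Finset (Fin 3 → ℤ)) (galerkinRHS (freqBall N : Finset (Fin 3 → ℤ)) ν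
          (fourierRestrict (freqBall N : Finset (Fin 3 → ℤ)) f) x) (k : Fin 3 → ℤ) -
        galerkinRHS (freqBall m : Finset (Fin 3 → ℤ)) ν (fourierRestrict (freqBall m : Finset (Fin 3 → ℤ)) f)
          (fun l : ↥(freqBall m : Finset (Fin 3 → ℤ)) => coeffExt (freqBall N : Finset (Fin 3 → ℤ)) x (l : Fin 3 → ℤ)) k‖ ≤
      cpl ν A θ m k := by
  classical
  have hsub : (freqBall m : Finset (Fin 3 → ℤ)) ⊆ freqBall N := freqBall_mono hmN
  have hkN : (k : Fin 3 → ℤ) ∈ (freqBall N : Finset (Fin 3 → ℤ)) := hsub k.2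
  -- Step 1: the difference is the Leray symbol of the difference of the convection symbols
  have hdiff0 : coeffExt (freqBall N : Finset (Fin 3 → ℤ)) (galerkinRHS (freqBall N : Finset (Fin 3 → ℤ)) ν
        (fourierRestrict (freqBall N : Finset (Fin 3 → ℤ)) f) x) (k : Fin 3 → ℤ) -
      galerkinRHS (freqBall m : Finset (Fin 3 → ℤ)) ν (fourierRestrict (freqBall m : Finset (Fin 3 → ℤ)) f)
        (fun l : ↥(freqBall m : Finset (Fin 3 → ℤ)) => coeffExt (freqBall N : Finset (Fin 3 → ℤ)) x (l : Fin 3 → ℤ)) k =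
      leraySym (k : Fin 3 → ℤ)
        (convectionCoeff (freqBall m : Finset (Fin 3 → ℤ))
            (coeffExt (freqBall m : Finset (Fin 3 → ℤ))
              (fun l : ↥(freqBall m : Finset (Fin 3 → ℤ)) => coeffExt (freqBall N : Finset (Fin 3 → ℤ)) x (l : Fin 3 → ℤ)))
            (coeffExt (freqBall m : Finset (Fin 3 → ℤ))
              (fun l : ↥(freqBall m : Finset (Fin 3 → ℤ)) => coeffExt (freqBall N : Finset (Fin 3 → ℤ)) x (l : Fin 3 → ℤ)))
            (k : Fin 3 → ℤ) -
          convectionCoeff (freqBall N : Finset (Fin 3 → ℤ)) (coeffExt (freqBall N : Finset (Fin 3 → ℤ)) x)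
            (coeffExt (freqBall N : Finset (Fin 3 → ℤ)) x) (k : Fin 3 → ℤ)) := by
    rw [coeffExt_of_mem _ hkN, galerkinRHS_apply, galerkinRHS_apply, galerkinField_def, galerkinField_def]
    simp only [coeffExt_coe, fourierRestrict_apply, coeffExt_of_mem _ hkN, leraySym_sub]
    abel
  rw [hdiff0]
  -- notation: the full family `xb`, its cut-off `yb` at level `m`, and the shell part `z`
  set xb : (Fin 3 → ℤ) → EuclideanSpace ℂ (Fin 3) := coeffExt (freqBall N : Finset (Fin 3 → ℤ)) x with hxb
  set yb : (Fin 3 → ℤ) → EuclideanSpace ℂ (Fin 3) := coeffExt (freqBall m : Finset (Fin 3 → ℤ))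
    (fun l : ↥(freqBall m : Finset (Fin 3 → ℤ)) => xb (l : Fin 3 → ℤ)) with hyb
  set z : (Fin 3 → ℤ) → EuclideanSpace ℂ (Fin 3) := xb - yb with hz
  -- values of yb and z
  have hyb_mem : ∀ j ∈ (freqBall m : Finset (Fin 3 → ℤ)), yb j = xb j := fun j hj => by
    rw [hyb, coeffExt_of_mem _ hj]
  have hyb_nmem : ∀ j ∉ (freqBall m : Finset (Fin 3 → ℤ)), yb j = 0 := fun j hj => by
    rw [hyb, coeffExt_of_not_mem _ hj]
  have hz_mem : ∀ j ∈ (freqBall m : Finset (Fin 3 → ℤ)), z j = 0 := fun j hj => by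
    rw [hz, Pi.sub_apply, hyb_mem j hj, sub_self]
  have hz_nmem : ∀ j ∉ (freqBall m : Finset (Fin 3 → ℤ)), z j = xb j := fun j hj => by
    rw [hz, Pi.sub_apply, hyb_nmem j hj, sub_zero]
  have hxb_le : ∀ j, ‖xb j‖ ≤ prof A θ j := norm_coeffExt_le_prof hA.le hθ.le x hx
  have hyb_le : ∀ j, ‖yb j‖ ≤ prof A θ j := fun j => by
    by_cases hj : j ∈ (freqBall m : Finset (Fin 3 → ℤ))
    · rw [hyb_mem j hj]; exact hxb_le j
    · rw [hyb_nmem j hj, norm_zero]; exact prof_nonneg hA.le hθ.le j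
  have hz_le : ∀ j, ‖z j‖ ≤ prof A θ j := fun j => by
    by_cases hj : j ∈ (freqBall m : Finset (Fin 3 → ℤ))
    · rw [hz_mem j hj, norm_zero]; exact prof_nonneg hA.le hθ.le j
    · rw [hz_nmem j hj]; exact hxb_le j
  -- tail membership gives the `m+1 ≤ |·|₁` floor
  have hfloor : ∀ j ∉ (freqBall m : Finset (Fin 3 → ℤ)), m + 1 ≤ l1 j := fun j hj =>
    succ_le_l1_of_sq_lt (not_mem_freqBall.1 hj)
  have hk2m : l1 (k : Fin 3 → ℤ) ≤ 2 * m := l1_le_two_mul_of_sq_le (mem_freqBall.1 k.2)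
  -- the cut-off family's convection symbol can be computed on the larger set
  rw [convectionCoeff_subset_eq hsub yb yb hyb_nmem hyb_nmem]
  refine (norm_leraySym_le _ _).trans ?_
  -- Step 2: bilinear splitting  B(xb,xb) - B(yb,yb) = B(z, xb) + B(yb, z)
  have hsplit : convectionCoeff (freqBall N : Finset (Fin 3 → ℤ)) xb xb (k : Fin 3 → ℤ) -
      convectionCoeff (freqBall N : Finset (Fin 3 → ℤ)) yb yb (k : Fin 3 → ℤ) =
      convectionCoeff (freqBall N : Finset (Fin 3 → ℤ)) z xb (k : Fin 3 → ℤ) +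
        convectionCoeff (freqBall N : Finset (Fin 3 → ℤ)) yb z (k : Fin 3 → ℤ) := by
    have exb : xb = yb + z := by rw [hz]; abel
    conv_lhs => rw [exb]
    rw [convectionCoeff_add_left, convectionCoeff_add_right, convectionCoeff_add_right]
    have : convectionCoeff (freqBall N : Finset (Fin 3 → ℤ)) z (yb + z) (k : Fin 3 → ℤ) =
        convectionCoeff (freqBall N : Finset (Fin 3 → ℤ)) z xb (k : Fin 3 → ℤ) := by rw [← exb]
    rw [convectionCoeff_add_right] at this
    rw [← this]
    abel
  rw [norm_sub_rev, hsplit]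
  refine (norm_add_le _ _).trans ?_
  -- Step 3: the two sums
  set ρ : ℕ := max (l1 (k : Fin 3 → ℤ)) m with hρ
  set P : ℝ := 1 + ((ρ : ℕ) : ℝ) with hP
  have hP0 : 0 < P := by rw [hP]; positivity
  have hC : 0 ≤ latC := latC_nonneg
  have hθρ : 0 ≤ θ ^ ρ := pow_nonneg hθ.le _
  -- (A): outside member k - l'
  have hA_sum : ∑ l' ∈ (freqBall N : Finset (Fin 3 → ℤ)), ‖z ((k : Fin 3 → ℤ) - l')‖ * ((l1 l' : ℕ) : ℝ) * ‖xb l'‖ ≤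
      3 * (A ^ 2 * θ ^ ρ) * (96 * latC * (P ^ 5)⁻¹) := by
    -- termwise against an indicator of the floor on k - l'
    have step : ∀ l' ∈ (freqBall N : Finset (Fin 3 → ℤ)),
        ‖z ((k : Fin 3 → ℤ) - l')‖ * ((l1 l' : ℕ) : ℝ) * ‖xb l'‖ ≤
          (if m + 1 ≤ l1 ((k : Fin 3 → ℤ) - l') then
            3 * (A ^ 2 * θ ^ ρ) * (((1 + ((l1 ((k : Fin 3 → ℤ) - l') : ℕ) : ℝ)) ^ 5)⁻¹ *
              ((1 + ((l1 l' : ℕ) : ℝ)) ^ 6)⁻¹) else 0) := by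
      intro l' _
      by_cases hj : ((k : Fin 3 → ℤ) - l') ∈ (freqBall m : Finset (Fin 3 → ℤ))
      · rw [hz_mem _ hj, norm_zero, zero_mul, zero_mul]
        split_ifs <;> positivity
      · rw [if_pos (hfloor _ hj)]
        calc ‖z ((k : Fin 3 → ℤ) - l')‖ * ((l1 l' : ℕ) : ℝ) * ‖xb l'‖
            ≤ prof A θ ((k : Fin 3 → ℤ) - l') * ((l1 l' : ℕ) : ℝ) * prof A θ l' := by
              have := hz_le ((k : Fin 3 → ℤ) - l'); have := hxb_le l'
              have : 0 ≤ prof A θ ((k : Fin 3 → ℤ) - l') := prof_nonneg hA.le hθ.le _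
              gcongr
          _ ≤ _ := by
              have := termA_le hA.le hθ.le hθ1 (k : Fin 3 → ℤ) l' hk2m (hfloor _ hj)
              simpa only [mul_assoc] using this
    refine (Finset.sum_le_sum step).trans ?_
    rw [← Finset.sum_filter]
    -- reindex l'' = k - l'
    have hinj : Set.InjOn (fun l' => (k : Fin 3 → ℤ) - l') ((freqBall N : Finset (Fin 3 → ℤ)).filter
        (fun l' => m + 1 ≤ l1 ((k : Fin 3 → ℤ) - l'))) := fun a _ b _ h => by simpa using h
    have himg : ((freqBall N : Finset (Fin 3 → ℤ)).filter (fun l' => m + 1 ≤ l1 ((k : Fin 3 → ℤ) - l'))).image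
        (fun l' => (k : Fin 3 → ℤ) - l') =
        (((freqBall N : Finset (Fin 3 → ℤ)).image (fun l' => (k : Fin 3 → ℤ) - l')).filter (fun j => m + 1 ≤ l1 j)) := by
      rw [Finset.filter_image]
    calc ∑ l' ∈ (freqBall N : Finset (Fin 3 → ℤ)).filter (fun l' => m + 1 ≤ l1 ((k : Fin 3 → ℤ) - l')),
          3 * (A ^ 2 * θ ^ ρ) * (((1 + ((l1 ((k : Fin 3 → ℤ) - l') : ℕ) : ℝ)) ^ 5)⁻¹ * ((1 + ((l1 l' : ℕ) : ℝ)) ^ 6)⁻¹)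
        = ∑ j ∈ (((freqBall N : Finset (Fin 3 → ℤ)).image (fun l' => (k : Fin 3 → ℤ) - l')).filter (fun j => m + 1 ≤ l1 j)),
          3 * (A ^ 2 * θ ^ ρ) * (((1 + ((l1 ((k : Fin 3 → ℤ) - j) : ℕ) : ℝ)) ^ 6)⁻¹ * ((1 + ((l1 j : ℕ) : ℝ)) ^ 5)⁻¹) := by
          rw [← himg, Finset.sum_image hinj]
          refine Finset.sum_congr rfl fun l' _ => ?_
          rw [sub_sub_cancel, mul_comm (((1 + ((l1 ((k : Fin 3 → ℤ) - l') : ℕ) : ℝ)) ^ 5)⁻¹)]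
      _ = 3 * (A ^ 2 * θ ^ ρ) * ∑ j ∈ (((freqBall N : Finset (Fin 3 → ℤ)).image (fun l' => (k : Fin 3 → ℤ) - l')).filter
            (fun j => m + 1 ≤ l1 j)),
          ((1 + ((l1 ((k : Fin 3 → ℤ) - j) : ℕ) : ℝ)) ^ 6)⁻¹ * ((1 + ((l1 j : ℕ) : ℝ)) ^ 5)⁻¹ := by rw [Finset.mul_sum]
      _ ≤ 3 * (A ^ 2 * θ ^ ρ) * (96 * latC * ((1 + ((max (l1 (k : Fin 3 → ℤ)) (m + 1) : ℕ) : ℝ)) ^ 5)⁻¹) :=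
          mul_le_mul_of_nonneg_left (keySum_le _ _ (m + 1)) (by positivity)
      _ ≤ 3 * (A ^ 2 * θ ^ ρ) * (96 * latC * (P ^ 5)⁻¹) := by
          gcongr
          rw [hP, hρ]
          have hmm : max (l1 (k : Fin 3 → ℤ)) m ≤ max (l1 (k : Fin 3 → ℤ)) (m + 1) := max_le_max le_rfl (Nat.le_succ m)
          have hmm' : ((max (l1 (k : Fin 3 → ℤ)) m : ℕ) : ℝ) ≤ ((max (l1 (k : Fin 3 → ℤ)) (m + 1) : ℕ) : ℝ) := by
            exact_mod_cast hmm
          linarith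
  -- (B): outside member l'
  have hB_sum : ∑ l' ∈ (freqBall N : Finset (Fin 3 → ℤ)), ‖yb ((k : Fin 3 → ℤ) - l')‖ * ((l1 l' : ℕ) : ℝ) * ‖z l'‖ ≤
      (A ^ 2 * θ ^ ρ) * (96 * latC * (P ^ 5)⁻¹) := by
    have step : ∀ l' ∈ (freqBall N : Finset (Fin 3 → ℤ)),
        ‖yb ((k : Fin 3 → ℤ) - l')‖ * ((l1 l' : ℕ) : ℝ) * ‖z l'‖ ≤
          (if m + 1 ≤ l1 l' then
            (A ^ 2 * θ ^ ρ) * (((1 + ((l1 ((k : Fin 3 → ℤ) - l') : ℕ) : ℝ)) ^ 6)⁻¹ * ((1 + ((l1 l' : ℕ) : ℝ)) ^ 5)⁻¹)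
          else 0) := by
      intro l' _
      by_cases hj : l' ∈ (freqBall m : Finset (Fin 3 → ℤ))
      · rw [hz_mem _ hj, norm_zero, mul_zero]
        split_ifs <;> positivity
      · rw [if_pos (hfloor _ hj)]
        calc ‖yb ((k : Fin 3 → ℤ) - l')‖ * ((l1 l' : ℕ) : ℝ) * ‖z l'‖
            ≤ prof A θ ((k : Fin 3 → ℤ) - l') * ((l1 l' : ℕ) : ℝ) * prof A θ l' := by
              have := hyb_le ((k : Fin 3 → ℤ) - l'); have := hz_le l'
              have : 0 ≤ prof A θ ((k : Fin 3 → ℤ) - l') := prof_nonneg hA.le hθ.le _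
              gcongr
          _ ≤ _ := termB_le hA.le hθ.le hθ1 (k : Fin 3 → ℤ) l' (hfloor _ hj)
    refine (Finset.sum_le_sum step).trans ?_
    rw [← Finset.sum_filter, ← Finset.mul_sum]
    refine (mul_le_mul_of_nonneg_left (keySum_le _ _ (m + 1)) (by positivity)).trans ?_
    gcongr
    rw [hP, hρ]
    have hmm : max (l1 (k : Fin 3 → ℤ)) m ≤ max (l1 (k : Fin 3 → ℤ)) (m + 1) := max_le_max le_rfl (Nat.le_succ m)
    have hmm' : ((max (l1 (k : Fin 3 → ℤ)) m : ℕ) : ℝ) ≤ ((max (l1 (k : Fin 3 → ℤ)) (m + 1) : ℕ) : ℝ) := by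
      exact_mod_cast hmm
    linarith
  -- Step 4: combine with the convection-norm lemma and the threshold
  have hnA := norm_convectionCoeff_le (freqBall N : Finset (Fin 3 → ℤ)) z xb (k : Fin 3 → ℤ)
  have hnB := norm_convectionCoeff_le (freqBall N : Finset (Fin 3 → ℤ)) yb z (k : Fin 3 → ℤ)
  have hpi : 0 < Real.pi := Real.pi_pos
  have htot : ‖convectionCoeff (freqBall N : Finset (Fin 3 → ℤ)) z xb (k : Fin 3 → ℤ)‖ +
      ‖convectionCoeff (freqBall N : Finset (Fin 3 → ℤ)) yb z (k : Fin 3 → ℤ)‖ ≤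
      768 * Real.pi * latC * (A ^ 2 * θ ^ ρ * (P ^ 5)⁻¹) := by
    have h1 := mul_le_mul_of_nonneg_left hA_sum (by positivity : (0 : ℝ) ≤ 2 * Real.pi)
    have h2 := mul_le_mul_of_nonneg_left hB_sum (by positivity : (0 : ℝ) ≤ 2 * Real.pi)
    have e : 2 * Real.pi * (3 * (A ^ 2 * θ ^ ρ) * (96 * latC * (P ^ 5)⁻¹)) +
        2 * Real.pi * ((A ^ 2 * θ ^ ρ) * (96 * latC * (P ^ 5)⁻¹)) = 768 * Real.pi * latC * (A ^ 2 * θ ^ ρ * (P ^ 5)⁻¹) := by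
      ring
    linarith
  refine htot.trans ?_
  -- 768 π C A² θ^ρ P^{-5} ≤ ν A θ^ρ P^{-4}  ⟸  768 π C A ≤ ν P
  rw [cpl_eq, ← hρ, ← hP]
  have hPm : (m : ℝ) + 1 ≤ P := by
    rw [hP, hρ]
    have : (m : ℝ) ≤ ((max (l1 (k : Fin 3 → ℤ)) m : ℕ) : ℝ) := by exact_mod_cast le_max_right _ _
    linarith
  have hth' : 768 * Real.pi * latC * A ≤ ν * P := hth.trans (mul_le_mul_of_nonneg_left hPm hν.le)
  rw [div_eq_mul_inv]
  have e4 : (P ^ 4)⁻¹ = P * (P ^ 5)⁻¹ := by field_simp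
  rw [e4]
  calc 768 * Real.pi * latC * (A ^ 2 * θ ^ ρ * (P ^ 5)⁻¹)
      = (768 * Real.pi * latC * A) * (A * θ ^ ρ * (P ^ 5)⁻¹) := by ring
    _ ≤ (ν * P) * (A * θ ^ ρ * (P ^ 5)⁻¹) := mul_le_mul_of_nonneg_right hth' (by positivity)
    _ = ν * A * θ ^ ρ * (P * (P ^ 5)⁻¹) := by ring

/-! ## §8 The piece `UniformTailEstimates` (verbatim), with the sweeping scale `M = max M₀ (max M₁ M₂)` -/

/-- **Piece P2 `UniformTailEstimates` of the tail-lift split — PROVED** (registered stub `stub_uniformTailEstimates` of line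
`TailLift`, crux stmt-AnomalousDissipation-10352; the statement is verbatim the second hypothesis of
`TailLiftSplit.uniformGalerkinTrap_of_tailLift`).  Thresholds: `M₀ > 288 C A/(π ν)` (entrance), `M₁ ≥ 768 π C A/ν`
(coupling), `(θ²)^{M₂} < δ / ((4π²+1)(A² C + 1))` (tail sums), `C = latC = (∑_{n∈ℤ}(1+|n|)^{-2})³`. -/
theorem stub_uniformTailEstimates :
    ∀ ν A θ δ : ℝ, 0 < ν → 0 < A → 0 < θ → θ < 1 → 0 < δ → ∃ M : ℕ, ∀ m N : ℕ, M ≤ m → m ≤ N →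
      ∀ x : ↥(freqBall N : Finset (Fin 3 → ℤ)) → EuclideanSpace ℂ (Fin 3),
        (∀ k : ↥(freqBall N : Finset (Fin 3 → ℤ)), ‖x k‖ ≤ A * θ ^ (∑ i, ((k : Fin 3 → ℤ) i).natAbs) / (1 + ∑ i, (((k : Fin 3 → ℤ) i).natAbs : ℝ)) ^ 6) →
        (∀ (g : ↥(freqBall N : Finset (Fin 3 → ℤ)) → EuclideanSpace ℂ (Fin 3)) (k : ↥(freqBall N : Finset (Fin 3 → ℤ))),
            ((m : ℕ) : ℝ) ^ 2 < freqNormSq (k : Fin 3 → ℤ) → g k = 0 →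
            ‖x k‖ = A * θ ^ (∑ i, ((k : Fin 3 → ℤ) i).natAbs) / (1 + ∑ i, (((k : Fin 3 → ℤ) i).natAbs : ℝ)) ^ 6 →
            (inner ℂ (x k) (galerkinRHS (freqBall N : Finset (Fin 3 → ℤ)) ν g x k)).re < 0) ∧
        (∀ (f : UnitAddTorus (Fin 3) → EuclideanSpace ℝ (Fin 3)) (k : ↥(freqBall m : Finset (Fin 3 → ℤ))),
            ‖coeffExt (freqBall N : Finset (Fin 3 → ℤ)) (galerkinRHS (freqBall N : Finset (Fin 3 → ℤ)) ν (fourierRestrict (freqBall N : Finset (Fin 3 → ℤ)) f) x) (k : Fin 3 → ℤ) -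
                galerkinRHS (freqBall m : Finset (Fin 3 → ℤ)) ν (fourierRestrict (freqBall m : Finset (Fin 3 → ℤ)) f)
                  (fun l : ↥(freqBall m : Finset (Fin 3 → ℤ)) => coeffExt (freqBall N : Finset (Fin 3 → ℤ)) x (l : Fin 3 → ℤ)) k‖ ≤
              ν * A * θ ^ (max (∑ j, ((k : Fin 3 → ℤ) j).natAbs) m) / (1 + ((max (∑ j, ((k : Fin 3 → ℤ) j).natAbs) m : ℕ) : ℝ)) ^ 4) ∧
        2⁻¹ * ∑ k : ↥(freqBall N : Finset (Fin 3 → ℤ)), ‖x k‖ ^ 2 ≤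
          2⁻¹ * ∑ l : ↥(freqBall m : Finset (Fin 3 → ℤ)), ‖coeffExt (freqBall N : Finset (Fin 3 → ℤ)) x (l : Fin 3 → ℤ)‖ ^ 2 + δ ∧
        4 * Real.pi ^ 2 * ∑ k : ↥(freqBall N : Finset (Fin 3 → ℤ)), freqNormSq (k : Fin 3 → ℤ) * ‖x k‖ ^ 2 ≤
          4 * Real.pi ^ 2 * ∑ l : ↥(freqBall m : Finset (Fin 3 → ℤ)),
            freqNormSq (l : Fin 3 → ℤ) * ‖coeffExt (freqBall N : Finset (Fin 3 → ℤ)) x (l : Fin 3 → ℤ)‖ ^ 2 + δ := by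
  intro ν A θ δ hν hA hθ hθ1 hδ
  have hC : 0 ≤ latC := latC_nonneg
  have hpi : 0 < Real.pi := Real.pi_pos
  obtain ⟨M₀, hM₀⟩ : ∃ M₀ : ℕ, 288 * latC * A / (Real.pi * ν) < M₀ := exists_nat_gt _
  obtain ⟨M₁, hM₁⟩ : ∃ M₁ : ℕ, 768 * Real.pi * latC * A / ν ≤ M₁ := exists_nat_ge _
  have hθ2 : θ ^ 2 < 1 := pow_lt_one₀ hθ.le hθ1 two_ne_zero
  obtain ⟨M₂, hM₂⟩ : ∃ M₂ : ℕ, (θ ^ 2) ^ M₂ < δ / ((4 * Real.pi ^ 2 + 1) * (A ^ 2 * latC + 1)) :=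
    exists_pow_lt_of_lt_one (by positivity) hθ2
  refine ⟨max M₀ (max M₁ M₂), fun m N hMm hmN x hx => ⟨?_, ?_, ?_⟩⟩
  · -- (i) per-mode tail entrance
    intro g k hk hg hnorm
    have hm0 : (M₀ : ℝ) ≤ m := by exact_mod_cast (le_max_left _ _).trans hMm
    have e : 288 * latC * A < (M₀ : ℝ) * (Real.pi * ν) := (div_lt_iff₀ (by positivity)).1 hM₀
    have e2 : (M₀ : ℝ) * (Real.pi * ν) ≤ (m : ℝ) * (Real.pi * ν) := mul_le_mul_of_nonneg_right hm0 (by positivity)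
    have e3 : Real.pi * ν * ((m : ℝ) + 1) = (m : ℝ) * (Real.pi * ν) + Real.pi * ν := by ring
    have hth : 288 * latC * A < Real.pi * ν * ((m : ℝ) + 1) := by
      rw [e3]; nlinarith [mul_pos hpi hν]
    exact entrance_clause hν hA hθ hθ1.le hth x g hx k hk hg hnorm
  · -- (ii) modewise coupling
    intro f k
    have hm1 : (M₁ : ℝ) ≤ m := by exact_mod_cast ((le_max_left _ _).trans (le_max_right _ _)).trans hMm
    have e : 768 * Real.pi * latC * A ≤ (M₁ : ℝ) * ν := (div_le_iff₀ hν).1 hM₁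
    have e2 : (M₁ : ℝ) * ν ≤ (m : ℝ) * ν := mul_le_mul_of_nonneg_right hm1 hν.le
    have e3 : ν * ((m : ℝ) + 1) = (m : ℝ) * ν + ν := by ring
    have hth : 768 * Real.pi * latC * A ≤ ν * ((m : ℝ) + 1) := by rw [e3]; linarith
    exact coupling_clause hν hA hθ hθ1.le hmN hth x hx f k
  · -- (iii)/(iv) tail energy and enstrophy
    have hm2 : M₂ ≤ m := ((le_max_right _ _).trans (le_max_right _ _)).trans hMm
    have hθm : θ ^ (2 * m) ≤ (θ ^ 2) ^ M₂ := by
      rw [pow_mul]; exact pow_le_pow_of_le_one (by positivity) hθ2.le hm2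
    have h1 : A ^ 2 * θ ^ (2 * m) * latC ≤ (A ^ 2 * latC + 1) * θ ^ (2 * m) := by
      nlinarith [pow_nonneg hθ.le (2 * m), mul_nonneg (sq_nonneg A) hC]
    have h2 : (A ^ 2 * latC + 1) * θ ^ (2 * m) ≤ (A ^ 2 * latC + 1) * (δ / ((4 * Real.pi ^ 2 + 1) * (A ^ 2 * latC + 1))) :=
      mul_le_mul_of_nonneg_left (hθm.trans hM₂.le) (by positivity)
    have h3 : (A ^ 2 * latC + 1) * (δ / ((4 * Real.pi ^ 2 + 1) * (A ^ 2 * latC + 1))) = δ / (4 * Real.pi ^ 2 + 1) := by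
      field_simp
    have hsmall : A ^ 2 * θ ^ (2 * m) * latC ≤ δ / (4 * Real.pi ^ 2 + 1) := by linarith
    have hfrac : δ / (4 * Real.pi ^ 2 + 1) ≤ δ := div_le_self hδ.le (by nlinarith)
    have hfrac2 : 4 * Real.pi ^ 2 * (δ / (4 * Real.pi ^ 2 + 1)) ≤ δ := by
      rw [mul_div_assoc', div_le_iff₀ (by positivity)]; nlinarith
    obtain ⟨tE, tZ⟩ := tail_sums_le hA.le hθ.le hθ1.le hmN x hx
    constructor
    · have : 2⁻¹ * (A ^ 2 * θ ^ (2 * m) * latC) ≤ δ := by linarith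
      linarith
    · have : 4 * Real.pi ^ 2 * (A ^ 2 * θ ^ (2 * m) * latC) ≤ δ :=
        (mul_le_mul_of_nonneg_left hsmall (by positivity)).trans hfrac2
      linarith

/-- Alias under the piece's name. -/
theorem uniformTailEstimates :
    ∀ ν A θ δ : ℝ, 0 < ν → 0 < A → 0 < θ → θ < 1 → 0 < δ → ∃ M : ℕ, ∀ m N : ℕ, M ≤ m → m ≤ N →
      ∀ x : ↥(freqBall N : Finset (Fin 3 → ℤ)) → EuclideanSpace ℂ (Fin 3),
        (∀ k : ↥(freqBall N : Finset (Fin 3 → ℤ)), ‖x k‖ ≤ A * θ ^ (∑ i, ((k : Fin 3 → ℤ) i).natAbs) / (1 + ∑ i, (((k : Fin 3 → ℤ) i).natAbs : ℝ)) ^ 6) →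
        (∀ (g : ↥(freqBall N : Finset (Fin 3 → ℤ)) → EuclideanSpace ℂ (Fin 3)) (k : ↥(freqBall N : Finset (Fin 3 → ℤ))),
            ((m : ℕ) : ℝ) ^ 2 < freqNormSq (k : Fin 3 → ℤ) → g k = 0 →
            ‖x k‖ = A * θ ^ (∑ i, ((k : Fin 3 → ℤ) i).natAbs) / (1 + ∑ i, (((k : Fin 3 → ℤ) i).natAbs : ℝ)) ^ 6 →
            (inner ℂ (x k) (galerkinRHS (freqBall N : Finset (Fin 3 → ℤ)) ν g x k)).re < 0) ∧
        (∀ (f : UnitAddTorus (Fin 3) → EuclideanSpace ℝ (Fin 3)) (k : ↥(freqBall m : Finset (Fin 3 → ℤ))),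
            ‖coeffExt (freqBall N : Finset (Fin 3 → ℤ)) (galerkinRHS (freqBall N : Finset (Fin 3 → ℤ)) ν (fourierRestrict (freqBall N : Finset (Fin 3 → ℤ)) f) x) (k : Fin 3 → ℤ) -
                galerkinRHS (freqBall m : Finset (Fin 3 → ℤ)) ν (fourierRestrict (freqBall m : Finset (Fin 3 → ℤ)) f)
                  (fun l : ↥(freqBall m : Finset (Fin 3 → ℤ)) => coeffExt (freqBall N : Finset (Fin 3 → ℤ)) x (l : Fin 3 → ℤ)) k‖ ≤
              ν * A * θ ^ (max (∑ j, ((k : Fin 3 → ℤ) j).natAbs) m) / (1 + ((max (∑ j, ((k : Fin 3 → ℤ) j).natAbs) m : ℕ) : ℝ)) ^ 4) ∧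
        2⁻¹ * ∑ k : ↥(freqBall N : Finset (Fin 3 → ℤ)), ‖x k‖ ^ 2 ≤
          2⁻¹ * ∑ l : ↥(freqBall m : Finset (Fin 3 → ℤ)), ‖coeffExt (freqBall N : Finset (Fin 3 → ℤ)) x (l : Fin 3 → ℤ)‖ ^ 2 + δ ∧
        4 * Real.pi ^ 2 * ∑ k : ↥(freqBall N : Finset (Fin 3 → ℤ)), freqNormSq (k : Fin 3 → ℤ) * ‖x k‖ ^ 2 ≤
          4 * Real.pi ^ 2 * ∑ l : ↥(freqBall m : Finset (Fin 3 → ℤ)),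
            freqNormSq (l : Fin 3 → ℤ) * ‖coeffExt (freqBall N : Finset (Fin 3 → ℤ)) x (l : Fin 3 → ℤ)‖ ^ 2 + δ :=
  stub_uniformTailEstimates

end Summit.AnomalousDissipation.AnomalousDissipation.Cruxes.UniformGalerkinTrap.TailEstimates

end
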